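import Mathlib

/-!
# Bubbling — assembly skeleton for obligation (B) `Stmt.stub_bubbling` (B-plan B12)

Crux workfile for `stmt-ValiantsHypothesis-19979` (`Theses.LacunarySymmetroid.DoorA26`), line
`Cruxes/DoorA26/Lines/wall_bubbling`, plan `Lines/wall_bubbling_B-plan.md` (§B12 + addendum 3).  Mathlib-only and
SELF-CONTAINED: Parts I–V are verbatim copies of the kernel-checked workfiles `Lines/wall_bubbling_TwistedRolleExp.lean`
(B1–B3), `Lines/wall_bubbling_Clusters.lean` (B8–B9), `Lines/wall_bubbling_Config.lean` (B4, B10a),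
`Lines/wall_bubbling_Normalisation.lean` (B5) and `Lines/wall_bubbling_Inertia.lean` (B11), re-namespaced under
`…WallBubbling.Assembly.*` so that this file elaborates alone (crux workfiles are not importable); Part VI is new:

* verbatim copies of the line's `TwentyLocus`, `SortedSimplex`, `polar`, `Realisable`, `BlockSumsZero`, `Stmt.stub_bubbling`
  (same bodies ⇒ the line lead transfers by `Iff.rfl`/defeq);
* `ClusterLimit δ⋆` — the typed OUTPUT of the bookkeeping steps B4–B7 (subsequence, clusters, recentring, normalisation,
  compactness, B11): per cluster the normalised coefficient sequences and their limits, the zero counts `m c` with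
  `∑ m c = 20`, the member-wise transfer identities between clusters, realisability of each limit;
* `count_absurd` — **B10b PROVED**: a `ClusterLimit` at a `δ⋆` with a pair-sum coincidence in which EVERY cluster keeps an
  active limit class is absurd (`20 ≤ ∑_c (|Λ_c| − 1) ≤ |V(δ⋆)| − 1 ≤ 19`; glues B3 + B8 + B9 + B10a);
* `stub_bubbling_of` — **B12 composition PROVED**: `(∀ δ⋆ ∈ closure TwentyLocus, Nonempty (ClusterLimit δ⋆)) → Stmt.stub_bubbling`;
* `zeros_of_mem_twentyLocus` (S3a: unpack the twenty-locus into `20` sorted real zeros of an `expSum` over the `36` members,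
  B5), `blocks` (S3b: B4 + B6 — subsequence, block starts, radius, drift), `clusterLimit_of_data` (S3c: B5/B7/B11 —
  recentring, max-normalisation, Bolzano–Weierstrass in `Fin C → Pair → ℝ`, transfer identities, realisability of the limits),
  `clusterLimit_of_mem_closure` (S3) and `stub_bubbling_proof : Stmt.stub_bubbling`.

HONEST FRAMING: ZERO `sorry`, no axioms beyond Mathlib's; `Stmt.stub_bubbling` here is a verbatim COPY
of the line's obligation (B) over verbatim copies of its definitions, not the route's own decl — the line lead transfers it by
`unfold`/defeq; nothing here proves `DoorA26` (obligations W, M, R of the line remain); VP ≠ VNP is not moved.  [folklore]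
-/



namespace Summit.ValiantsHypothesis.ValiantsHypothesis.Cruxes.DoorA26.WallBubbling.Assembly.TwistedRolle

/-! # Part I — verbatim copy of `Lines/wall_bubbling_TwistedRolleExp.lean` (B1–B3, kernel-checked) -/


open Finset Filter Topology

variable {ι : Type*} [Fintype ι]

/-- The real exponential sum `t ↦ ∑ i, a i · exp (x i · t)`. [folklore] -/
noncomputable def expSum (a x : ι → ℝ) (t : ℝ) : ℝ := ∑ i, a i * Real.exp (x i * t)

/-- The merged coefficient of the exponent value `w`: `∑_{i : x i = w} a i`. [folklore] -/
noncomputable def classSum (a x : ι → ℝ) (w : ℝ) : ℝ := ∑ i, if x i = w then a i else 0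

/-! ## B2 — twist algebra -/

/-- Multiplying by `exp (−v t)` shifts every exponent by `−v`. [folklore] -/
theorem expSum_twist (a x : ι → ℝ) (v t : ℝ) :
    Real.exp (-(v * t)) * expSum a x t = expSum a (fun i => x i - v) t := by
  unfold expSum
  rw [Finset.mul_sum]
  refine Finset.sum_congr rfl fun i _ => ?_
  rw [sub_mul, Real.exp_sub, Real.exp_neg]
  ring

/-- The derivative of an exponential sum is the exponential sum with coefficients `a i · x i`. [folklore] -/
theorem hasDerivAt_expSum (a x : ι → ℝ) (t : ℝ) :
    HasDerivAt (expSum a x) (expSum (fun i => a i * x i) x t) t := by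
  have h : HasDerivAt (fun s => ∑ i, a i * Real.exp (x i * s))
      (∑ i, a i * (Real.exp (x i * t) * (x i * 1))) t := by
    apply HasDerivAt.fun_sum
    intro i _
    exact (((hasDerivAt_id' t).const_mul (x i)).exp).const_mul (a i)
  have hfun : expSum a x = fun s => ∑ i, a i * Real.exp (x i * s) := rfl
  rw [hfun]
  convert h using 1
  unfold expSum
  refine Finset.sum_congr rfl fun i _ => ?_
  ring

/-- Grouping an exponential sum by exponent classes. [folklore] -/
theorem expSum_eq_sum_classes [DecidableEq ℝ] (a x : ι → ℝ) (t : ℝ) :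
    expSum a x t = ∑ w ∈ Finset.univ.image x, Real.exp (w * t) * classSum a x w := by
  unfold expSum classSum
  symm
  rw [← Finset.sum_fiberwise_of_maps_to (s := Finset.univ) (t := Finset.univ.image x) (g := x)
    (fun i hi => Finset.mem_image_of_mem x hi) (fun i => a i * Real.exp (x i * t))]
  refine Finset.sum_congr rfl fun w _ => ?_
  rw [Finset.sum_filter, Finset.mul_sum]
  refine Finset.sum_congr rfl fun i _ => ?_
  by_cases h : x i = w
  · rw [if_pos h, if_pos h, h]
    ring
  · rw [if_neg h, if_neg h, mul_zero]

/-- With a single active class `w₀` the limit sum is the monomial `exp (w₀ t) · classSum w₀`. [folklore] -/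
theorem expSum_eq_of_single_class (a x : ι → ℝ) (w₀ : ℝ)
    (hA : ∀ w, w ≠ w₀ → classSum a x w = 0) (t : ℝ) :
    expSum a x t = Real.exp (w₀ * t) * classSum a x w₀ := by
  classical
  rw [expSum_eq_sum_classes]
  refine Finset.sum_eq_single w₀ (fun w _ hw => ?_) (fun hw₀ => ?_)
  · rw [hA w hw, mul_zero]
  · have : classSum a x w₀ = 0 := by
      unfold classSum
      refine Finset.sum_eq_zero fun i _ => ?_
      rw [if_neg]
      intro h
      exact hw₀ (h ▸ Finset.mem_image_of_mem x (Finset.mem_univ i))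
    rw [this, mul_zero]

/-- The class sums of the twisted and differentiated data: `classSum' u = u · classSum (u + v)`. [folklore] -/
theorem classSum_twist (a x : ι → ℝ) (v u : ℝ) :
    classSum (fun i => a i * (x i - v)) (fun i => x i - v) u = u * classSum a x (u + v) := by
  unfold classSum
  rw [Finset.mul_sum]
  refine Finset.sum_congr rfl fun i _ => ?_
  dsimp only
  by_cases h : x i - v = u
  · have h' : x i = u + v := by linarith
    rw [if_pos h, if_pos h', h]
    ring
  · have h' : ¬ x i = u + v := fun h'' => h (by linarith)
    rw [if_neg h, if_neg h', mul_zero]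

/-! ## B1 — Rolle count (distinct zeros only) -/

/-- Between `m + 1` strictly increasing zeros of `φ` lie `m` strictly increasing zeros of `φ'`. [folklore: Rolle] -/
theorem rolle_count_fin {φ φ' : ℝ → ℝ} (hφ : ∀ t, HasDerivAt φ (φ' t) t) {m : ℕ}
    (z : Fin (m + 1) → ℝ) (hz : StrictMono z) (h0 : ∀ i, φ (z i) = 0) :
    ∃ c : Fin m → ℝ, StrictMono c ∧ (∀ k, z k.castSucc < c k ∧ c k < z k.succ) ∧ ∀ k, φ' (c k) = 0 := by
  have hrolle : ∀ k : Fin m, ∃ c, z k.castSucc < c ∧ c < z k.succ ∧ φ' c = 0 := by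
    intro k
    have hlt : z k.castSucc < z k.succ := hz Fin.castSucc_lt_succ
    obtain ⟨c, hc, hc0⟩ := exists_hasDerivAt_eq_zero hlt
      (fun t _ => (hφ t).continuousAt.continuousWithinAt)
      (by rw [h0, h0]) (fun t _ => hφ t)
    exact ⟨c, hc.1, hc.2, hc0⟩
  choose c hc1 hc2 hc0 using hrolle
  refine ⟨c, ?_, fun k => ⟨hc1 k, hc2 k⟩, hc0⟩
  intro k k' hkk'
  have hle : z k.succ ≤ z k'.castSucc := by
    apply hz.monotone
    rw [Fin.le_def]
    simp only [Fin.val_succ, Fin.val_castSucc]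
    exact hkk'
  calc c k < z k.succ := hc2 k
    _ ≤ z k'.castSucc := hle
    _ < c k' := hc1 k'

/-- **B1.** If `φ` vanishes on a finite set `Z ⊆ [A, B]` then `φ'` vanishes on a finite set `Z' ⊆ [A, B]` with
`Z.card ≤ Z'.card + 1` — distinct zeros only, no multiplicities. [folklore: Rolle] -/
theorem rolle_count {φ φ' : ℝ → ℝ} (hφ : ∀ t, HasDerivAt φ (φ' t) t) (A B : ℝ) (Z : Finset ℝ)
    (hZ : ∀ z ∈ Z, z ∈ Set.Icc A B ∧ φ z = 0) :
    ∃ Z' : Finset ℝ, Z.card ≤ Z'.card + 1 ∧ ∀ z ∈ Z', z ∈ Set.Icc A B ∧ φ' z = 0 := by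
  classical
  rcases Nat.lt_or_ge Z.card 1 with hsmall | hbig
  · exact ⟨∅, by simp; omega, by simp⟩
  obtain ⟨m, hm⟩ : ∃ m, Z.card = m + 1 := ⟨Z.card - 1, by omega⟩
  let e : Fin (m + 1) ↪o ℝ := Z.orderEmbOfFin hm
  have he_mem : ∀ i, e i ∈ Z := fun i => Z.orderEmbOfFin_mem hm i
  obtain ⟨c, hcmono, hcbetween, hc0⟩ := rolle_count_fin hφ e e.strictMono (fun i => (hZ _ (he_mem i)).2)
  refine ⟨Finset.univ.image c, ?_, ?_⟩
  · rw [Finset.card_image_of_injective _ hcmono.injective, Finset.card_univ, Fintype.card_fin]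
    omega
  · intro w hw
    obtain ⟨k, _, rfl⟩ := Finset.mem_image.mp hw
    refine ⟨⟨?_, ?_⟩, hc0 k⟩
    · exact le_trans (hZ _ (he_mem _)).1.1 (hcbetween k).1.le
    · exact le_trans (hcbetween k).2.le (hZ _ (he_mem _)).1.2

/-! ## B3 — the robust term count -/

/-- Single active class ⇒ no zeros in a fixed window for all large `ν`.  Proof by sequential compactness:
a sequence of zeros `t_ν ∈ [−R, R]` would accumulate at some `t₀` where the limit sum equals
`exp (w₀ t₀) · classSum w₀ ≠ 0`. [folklore] -/
theorem eventually_no_zero (a x : ℕ → ι → ℝ) (a₀ x₀ : ι → ℝ) (w₀ : ℝ)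
    (ha : ∀ i, Tendsto (fun ν => a ν i) atTop (𝓝 (a₀ i)))
    (hx : ∀ i, Tendsto (fun ν => x ν i) atTop (𝓝 (x₀ i)))
    (hw₀ : classSum a₀ x₀ w₀ ≠ 0) (hA : ∀ w, w ≠ w₀ → classSum a₀ x₀ w = 0) (R : ℝ) :
    ∀ᶠ ν in atTop, ∀ t ∈ Set.Icc (-R) R, expSum (a ν) (x ν) t ≠ 0 := by
  by_contra H
  have H' : ∃ᶠ ν in atTop, ∃ t ∈ Set.Icc (-R) R, expSum (a ν) (x ν) t = 0 := by
    rw [Filter.not_eventually] at H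
    refine H.mono fun ν h => ?_
    by_contra h'
    apply h
    intro t ht h0
    exact h' ⟨t, ht, h0⟩
  obtain ⟨φ, hφ, hφP⟩ := Filter.extraction_of_frequently_atTop H'
  choose t ht h0 using hφP
  obtain ⟨t₀, _, ψ, hψ, hlim⟩ := isCompact_Icc.tendsto_subseq ht
  have hsub : Tendsto (φ ∘ ψ) atTop atTop := (hφ.comp hψ).tendsto_atTop
  have key : Tendsto (fun n => expSum (a (φ (ψ n))) (x (φ (ψ n))) (t (ψ n))) atTop
      (𝓝 (expSum a₀ x₀ t₀)) := by
    unfold expSum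
    apply tendsto_finsetSum
    intro i _
    have h1 : Tendsto (fun n => a (φ (ψ n)) i) atTop (𝓝 (a₀ i)) := (ha i).comp hsub
    have h2 : Tendsto (fun n => x (φ (ψ n)) i) atTop (𝓝 (x₀ i)) := (hx i).comp hsub
    have h3 : Tendsto (fun n => x (φ (ψ n)) i * t (ψ n)) atTop (𝓝 (x₀ i * t₀)) := h2.mul hlim
    exact h1.mul ((Real.continuous_exp.tendsto _).comp h3)
  have hzero : (fun n => expSum (a (φ (ψ n))) (x (φ (ψ n))) (t (ψ n))) = fun _ => (0 : ℝ) :=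
    funext fun n => h0 (ψ n)
  rw [hzero] at key
  have hlim0 : expSum a₀ x₀ t₀ = 0 := (tendsto_const_nhds_iff.mp key).symm
  rw [expSum_eq_of_single_class a₀ x₀ w₀ hA t₀] at hlim0
  exact hw₀ ((mul_eq_zero.mp hlim0).resolve_left (Real.exp_pos _).ne')

/-- **B3 (robust term count).**  Let `g_ν = expSum (a ν) (x ν)` with coefficientwise and exponentwise limits
`a₀, x₀`.  If every ACTIVE limit class (`classSum a₀ x₀ w ≠ 0`) lies in a finset `V` with `V.card ≤ n + 1`, and some
class is active, then for every window `[−R, R]` and all large `ν`, every finite set of zeros of `g_ν` in the window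
has at most `n` elements.  Proof: induction on `n`; with one active class use `eventually_no_zero`; otherwise twist
at an active exponent `w₀` (`expSum_twist`), differentiate (`hasDerivAt_expSum`), count with `rolle_count`, and apply
the induction hypothesis to the twisted family, whose active classes are `{w − w₀ : w active, w ≠ w₀}`
(`classSum_twist`).  No multiplicities, no Hurwitz. [folklore: Laguerre's twisted Rolle] -/
theorem robust_term_count (n : ℕ) :
    ∀ (a x : ℕ → ι → ℝ) (a₀ x₀ : ι → ℝ) (V : Finset ℝ),
      (∀ i, Tendsto (fun ν => a ν i) atTop (𝓝 (a₀ i))) →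
      (∀ i, Tendsto (fun ν => x ν i) atTop (𝓝 (x₀ i))) →
      (∀ w, classSum a₀ x₀ w ≠ 0 → w ∈ V) → V.card ≤ n + 1 →
      (∃ w, classSum a₀ x₀ w ≠ 0) →
      ∀ R : ℝ, ∀ᶠ ν in atTop, ∀ Z : Finset ℝ,
        (∀ z ∈ Z, z ∈ Set.Icc (-R) R ∧ expSum (a ν) (x ν) z = 0) → Z.card ≤ n := by
  classical
  induction n with
  | zero =>
    intro a x a₀ x₀ V ha hx hV hcard hne R
    obtain ⟨w₀, hw₀⟩ := hne
    have hA : ∀ w, w ≠ w₀ → classSum a₀ x₀ w = 0 := by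
      intro w hw
      by_contra h
      exact hw (Finset.card_le_one.mp (by omega) w (hV w h) w₀ (hV w₀ hw₀))
    filter_upwards [eventually_no_zero a x a₀ x₀ w₀ ha hx hw₀ hA R] with ν hν Z hZ
    rw [Nat.le_zero, Finset.card_eq_zero, Finset.eq_empty_iff_forall_notMem]
    intro z hz
    exact hν z (hZ z hz).1 (hZ z hz).2
  | succ n ih =>
    intro a x a₀ x₀ V ha hx hV hcard hne R
    obtain ⟨w₀, hw₀⟩ := hne
    by_cases hA : ∀ w, w ≠ w₀ → classSum a₀ x₀ w = 0
    · filter_upwards [eventually_no_zero a x a₀ x₀ w₀ ha hx hw₀ hA R] with ν hν Z hZ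
      have : Z = ∅ := by
        rw [Finset.eq_empty_iff_forall_notMem]
        intro z hz
        exact hν z (hZ z hz).1 (hZ z hz).2
      rw [this, Finset.card_empty]
      exact Nat.zero_le _
    · -- a second active class `w₁ ≠ w₀`: twist at `w₀`
      obtain ⟨w₁, hw₁⟩ : ∃ w₁, w₁ ≠ w₀ ∧ classSum a₀ x₀ w₁ ≠ 0 := by
        by_contra h
        apply hA
        intro w hw
        by_contra h'
        exact h ⟨w, hw, h'⟩
      -- twisted data
      set a' : ℕ → ι → ℝ := fun ν i => a ν i * (x ν i - w₀) with ha'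
      set x' : ℕ → ι → ℝ := fun ν i => x ν i - w₀ with hx'
      set a₀' : ι → ℝ := fun i => a₀ i * (x₀ i - w₀) with ha₀'
      set x₀' : ι → ℝ := fun i => x₀ i - w₀ with hx₀'
      set V' : Finset ℝ := (V.erase w₀).image (fun w => w - w₀) with hV'
      have ha't : ∀ i, Tendsto (fun ν => a' ν i) atTop (𝓝 (a₀' i)) :=
        fun i => (ha i).mul ((hx i).sub_const w₀)
      have hx't : ∀ i, Tendsto (fun ν => x' ν i) atTop (𝓝 (x₀' i)) :=
        fun i => (hx i).sub_const w₀
      have hclass : ∀ u, classSum a₀' x₀' u = u * classSum a₀ x₀ (u + w₀) :=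
        fun u => classSum_twist a₀ x₀ w₀ u
      have hw₀V : w₀ ∈ V := hV w₀ hw₀
      have hV'cov : ∀ u, classSum a₀' x₀' u ≠ 0 → u ∈ V' := by
        intro u hu
        rw [hclass] at hu
        have hu0 : u ≠ 0 := by
          rintro rfl
          exact hu (zero_mul _)
        have hmem : u + w₀ ∈ V := hV _ (right_ne_zero_of_mul hu)
        rw [hV', Finset.mem_image]
        refine ⟨u + w₀, Finset.mem_erase.mpr ⟨?_, hmem⟩, by ring⟩
        intro h
        apply hu0
        linarith
      have hV'card : V'.card ≤ n + 1 := by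
        calc V'.card ≤ (V.erase w₀).card := Finset.card_image_le
          _ = V.card - 1 := Finset.card_erase_of_mem hw₀V
          _ ≤ n + 1 := by omega
      have hne' : ∃ u, classSum a₀' x₀' u ≠ 0 := by
        refine ⟨w₁ - w₀, ?_⟩
        rw [hclass, sub_add_cancel]
        exact mul_ne_zero (sub_ne_zero.mpr hw₁.1) hw₁.2
      filter_upwards [ih a' x' a₀' x₀' V' ha't hx't hV'cov hV'card hne' R] with ν hν Z hZ
      -- zeros of `g_ν` are zeros of the twisted sum, whose derivative is the twisted-differentiated sum
      have hderiv : ∀ s, HasDerivAt (expSum (a ν) (x' ν)) (expSum (a' ν) (x' ν) s) s :=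
        fun s => hasDerivAt_expSum (a ν) (x' ν) s
      have hZ' : ∀ z ∈ Z, z ∈ Set.Icc (-R) R ∧ expSum (a ν) (x' ν) z = 0 := by
        intro z hz
        refine ⟨(hZ z hz).1, ?_⟩
        have := expSum_twist (a ν) (x ν) w₀ z
        rw [(hZ z hz).2, mul_zero] at this
        exact this.symm
      obtain ⟨Z', hcardZ', hZ'0⟩ := rolle_count hderiv (-R) R Z hZ'
      have := hν Z' hZ'0
      omega

/-- **B3, counted form.**  Same hypotheses with `V` = the set of active classes itself: for all large `ν`, a finite
set of zeros of `g_ν` in `[−R, R]` has at most `V.card − 1` elements. [folklore] -/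
theorem robust_term_count' (a x : ℕ → ι → ℝ) (a₀ x₀ : ι → ℝ) (V : Finset ℝ)
    (ha : ∀ i, Tendsto (fun ν => a ν i) atTop (𝓝 (a₀ i)))
    (hx : ∀ i, Tendsto (fun ν => x ν i) atTop (𝓝 (x₀ i)))
    (hV : ∀ w, classSum a₀ x₀ w ≠ 0 → w ∈ V) (hne : ∃ w, classSum a₀ x₀ w ≠ 0) (R : ℝ) :
    ∀ᶠ ν in atTop, ∀ Z : Finset ℝ,
      (∀ z ∈ Z, z ∈ Set.Icc (-R) R ∧ expSum (a ν) (x ν) z = 0) → Z.card + 1 ≤ V.card := by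
  have hVpos : 1 ≤ V.card := by
    obtain ⟨w, hw⟩ := hne
    exact Finset.card_pos.mpr ⟨w, hV w hw⟩
  filter_upwards [robust_term_count (V.card - 1) a x a₀ x₀ V ha hx hV (by omega) hne R] with ν hν Z hZ
  have := hν Z hZ
  omega


end Summit.ValiantsHypothesis.ValiantsHypothesis.Cruxes.DoorA26.WallBubbling.Assembly.TwistedRolle

namespace Summit.ValiantsHypothesis.ValiantsHypothesis.Cruxes.DoorA26.WallBubbling.Assembly.Clusters

/-! # Part II — verbatim copy of `Lines/wall_bubbling_Clusters.lean` (B8–B9, kernel-checked) -/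


open Finset Filter Topology

/-! ## B8 — tropical monotonicity (member-wise transfer) -/

/-- **B8.**  Member-wise tropical monotonicity between two clusters at distance `L_ν → +∞`. [folklore] -/
theorem tropical_monotone {ι : Type*} (x H H' : ℕ → ι → ℝ) (x₀ h h' : ι → ℝ) (L ρ : ℕ → ℝ)
    (hx : ∀ i, Tendsto (fun ν => x ν i) atTop (𝓝 (x₀ i)))
    (hH : ∀ i, Tendsto (fun ν => H ν i) atTop (𝓝 (h i)))
    (hH' : ∀ i, Tendsto (fun ν => H' ν i) atTop (𝓝 (h' i)))
    (hbound : ∀ ν i, |H ν i| ≤ 1) (hbound' : ∀ ν i, |H' ν i| ≤ 1)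
    (hρ : ∀ ν, 0 < ρ ν) (hL : Tendsto L atTop atTop)
    (htransfer : ∀ ν i, H' ν i = H ν i * Real.exp (x ν i * L ν) * ρ ν)
    {m m' : ι} (hm : h m ≠ 0) (hm' : h' m' ≠ 0) : x₀ m ≤ x₀ m' := by
  by_contra hlt
  push Not at hlt
  -- positive margins
  set d : ℝ := (x₀ m - x₀ m') / 2 with hd
  have hdpos : 0 < d := by rw [hd]; linarith
  set κ : ℝ := |h m| / 2 with hκ
  set κ' : ℝ := |h' m'| / 2 with hκ'
  have hκpos : 0 < κ := by rw [hκ]; exact half_pos (abs_pos.mpr hm)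
  have hκ'pos : 0 < κ' := by rw [hκ']; exact half_pos (abs_pos.mpr hm')
  -- eventual facts
  have e1 : ∀ᶠ ν in atTop, κ < |H ν m| :=
    ((hH m).abs).eventually_const_lt (by rw [hκ]; linarith [abs_pos.mpr hm])
  have e2 : ∀ᶠ ν in atTop, κ' < |H' ν m'| :=
    ((hH' m').abs).eventually_const_lt (by rw [hκ']; linarith [abs_pos.mpr hm'])
  have e3 : ∀ᶠ ν in atTop, d < x ν m - x ν m' :=
    ((hx m).sub (hx m')).eventually_const_lt (by rw [hd]; linarith)
  have e4 : ∀ᶠ ν in atTop, 0 ≤ L ν := hL.eventually_ge_atTop 0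
  have e5 : ∀ᶠ ν in atTop, 1 / (κ * κ') < Real.exp (d * L ν) :=
    (Real.tendsto_exp_atTop.comp (Filter.Tendsto.const_mul_atTop hdpos hL)).eventually_gt_atTop _
  have hfalse : ∀ᶠ ν : ℕ in atTop, False := by
    filter_upwards [e1, e2, e3, e4, e5] with ν h1 h2 h3 h4 h5
    set E : ℝ := Real.exp (x ν m * L ν) with hE
    set E' : ℝ := Real.exp (x ν m' * L ν) with hE'
    have hEpos : 0 < E := Real.exp_pos _
    have hE'pos : 0 < E' := Real.exp_pos _
    have hρν := hρ ν
    -- |H' m| = |H m| E ρ ≤ 1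
    have hb1 : |H ν m| * (E * ρ ν) ≤ 1 := by
      have := hbound' ν m
      rw [htransfer ν m, abs_mul, abs_mul, abs_of_pos hEpos, abs_of_pos hρν] at this
      linarith [this]
    -- κ' < |H' m'| = |H m'| E' ρ ≤ E' ρ
    have hb2 : κ' < E' * ρ ν := by
      have h2' := h2
      rw [htransfer ν m', abs_mul, abs_mul, abs_of_pos hE'pos, abs_of_pos hρν] at h2'
      have : |H ν m'| * E' * ρ ν ≤ 1 * E' * ρ ν := by
        apply mul_le_mul_of_nonneg_right _ hρν.le
        exact mul_le_mul_of_nonneg_right (hbound ν m') hE'pos.le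
      linarith
    -- exp (d L) E' ≤ E
    have hb3 : Real.exp (d * L ν) * E' ≤ E := by
      rw [hE, hE', ← Real.exp_add]
      apply Real.exp_le_exp.mpr
      nlinarith [mul_nonneg (sub_nonneg.mpr h3.le) h4]
    -- chain
    have hchain : κ * (Real.exp (d * L ν) * κ') ≤ 1 := by
      calc κ * (Real.exp (d * L ν) * κ')
          ≤ κ * (Real.exp (d * L ν) * (E' * ρ ν)) := by
            apply mul_le_mul_of_nonneg_left _ hκpos.le
            exact mul_le_mul_of_nonneg_left hb2.le (Real.exp_pos _).le
        _ = κ * ((Real.exp (d * L ν) * E') * ρ ν) := by ring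
        _ ≤ κ * (E * ρ ν) := by
            apply mul_le_mul_of_nonneg_left _ hκpos.le
            exact mul_le_mul_of_nonneg_right hb3 hρν.le
        _ ≤ |H ν m| * (E * ρ ν) := by
            exact mul_le_mul_of_nonneg_right h1.le (mul_pos hEpos hρν).le
        _ ≤ 1 := hb1
    have h5' : 1 < Real.exp (d * L ν) * (κ * κ') := (div_lt_iff₀ (mul_pos hκpos hκ'pos)).mp h5
    nlinarith [hchain, h5']
  exact hfalse.exists.elim fun _ h => h

/-- A nonzero class sum has a nonzero member (the bridge from the class form of B3 to the member form of B8).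
[folklore] -/
theorem exists_member_of_classSum_ne_zero {ι : Type*} [Fintype ι] (a x : ι → ℝ) (w : ℝ)
    (h : (∑ i, if x i = w then a i else 0) ≠ 0) : ∃ i, x i = w ∧ a i ≠ 0 := by
  obtain ⟨i, _, hi⟩ := Finset.exists_ne_zero_of_sum_ne_zero h
  by_cases hx : x i = w
  · rw [if_pos hx] at hi
    exact ⟨i, hx, hi⟩
  · rw [if_neg hx] at hi
    exact absurd rfl hi

/-! ## B9 — the interval count -/

/-- **B9.**  Monotonically ordered nonempty finsets inside `V` satisfy `∑ c, (|Λ c| − 1) ≤ |V| − 1`. [folklore] -/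
theorem interval_count (V : Finset ℝ) {C : ℕ} (Λ : Fin C → Finset ℝ) (hne : ∀ c, (Λ c).Nonempty)
    (hsub : ∀ c, Λ c ⊆ V) (hmono : ∀ c c', c < c' → ∀ w ∈ Λ c, ∀ w' ∈ Λ c', w ≤ w') :
    ∑ c, ((Λ c).card - 1) ≤ V.card - 1 := by
  classical
  cases C with
  | zero => simp
  | succ C' =>
    set A : Fin (C' + 1) → Finset ℝ := fun c => (Λ c).erase ((Λ c).max' (hne c)) with hA
    have hAcard : ∀ c, (A c).card = (Λ c).card - 1 := fun c =>
      Finset.card_erase_of_mem (Finset.max'_mem _ _)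
    -- members of `A c` lie strictly below `max' (Λ c)`
    have hAlt : ∀ c, ∀ w ∈ A c, w < (Λ c).max' (hne c) := by
      intro c w hw
      obtain ⟨hne', hmem⟩ := Finset.mem_erase.mp hw
      exact lt_of_le_of_ne (Finset.le_max' _ _ hmem) hne'
    have hAsub : ∀ c, ∀ w ∈ A c, w ∈ Λ c := fun c w hw => (Finset.mem_erase.mp hw).2
    -- pairwise disjoint
    have hdisj : ∀ c c', c < c' → Disjoint (A c) (A c') := by
      intro c c' hcc'
      rw [Finset.disjoint_left]
      intro w hw hw'
      have h1 : w < (Λ c).max' (hne c) := hAlt c w hw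
      have h2 : (Λ c).max' (hne c) ≤ w := hmono c c' hcc' _ (Finset.max'_mem _ _) w (hAsub c' w hw')
      linarith
    have hpd : (↑(Finset.univ : Finset (Fin (C' + 1))) : Set (Fin (C' + 1))).PairwiseDisjoint A := by
      intro c _ c' _ hcc'
      change Disjoint (A c) (A c')
      rcases lt_or_gt_of_ne hcc' with hlt | hgt
      · exact hdisj c c' hlt
      · exact (hdisj c' c hgt).symm
    -- the union misses the last maximum
    set top : ℝ := (Λ (Fin.last C')).max' (hne _) with htop
    have htopV : top ∈ V := hsub _ (Finset.max'_mem _ _)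
    have hUsub : Finset.univ.biUnion A ⊆ V.erase top := by
      intro w hw
      obtain ⟨c, _, hwc⟩ := Finset.mem_biUnion.mp hw
      refine Finset.mem_erase.mpr ⟨?_, hsub c (hAsub c w hwc)⟩
      have hwlt : w < (Λ c).max' (hne c) := hAlt c w hwc
      rcases (Fin.le_last c).lt_or_eq with hlt | heq
      · have : (Λ c).max' (hne c) ≤ top :=
          hmono c (Fin.last C') hlt _ (Finset.max'_mem _ _) _ (Finset.max'_mem _ _)
        exact ne_of_lt (lt_of_lt_of_le hwlt this)
      · subst heq
        exact ne_of_lt hwlt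
    calc ∑ c, ((Λ c).card - 1) = ∑ c, (A c).card := by simp_rw [hAcard]
      _ = (Finset.univ.biUnion A).card := (Finset.card_biUnion hpd).symm
      _ ≤ (V.erase top).card := Finset.card_le_card hUsub
      _ = V.card - 1 := Finset.card_erase_of_mem htopV


end Summit.ValiantsHypothesis.ValiantsHypothesis.Cruxes.DoorA26.WallBubbling.Assembly.Clusters

namespace Summit.ValiantsHypothesis.ValiantsHypothesis.Cruxes.DoorA26.WallBubbling.Assembly.Config

/-! # Part III — verbatim copy of `Lines/wall_bubbling_Config.lean` (B4, B10a, kernel-checked) -/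


open Finset Filter Topology

/-! ## Subsequences -/

/-- An unbounded-above real sequence has a subsequence tending to `+∞`. [folklore] -/
theorem exists_subseq_tendsto_atTop_of_not_bddAbove (u : ℕ → ℝ) (h : ¬ BddAbove (Set.range u)) :
    ∃ ψ : ℕ → ℕ, StrictMono ψ ∧ Tendsto (u ∘ ψ) atTop atTop := by
  have hfreq : ∀ M : ℝ, ∃ᶠ k in atTop, M < u k := by
    intro M
    rw [Filter.frequently_atTop]
    intro a
    by_contra hcon
    push Not at hcon
    apply h
    refine ⟨max M (∑ k ∈ Finset.range a, |u k|), ?_⟩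
    rintro y ⟨k, rfl⟩
    rcases Nat.lt_or_ge k a with hk | hk
    · have : |u k| ≤ ∑ k ∈ Finset.range a, |u k| :=
        Finset.single_le_sum (f := fun k => |u k|) (fun _ _ => abs_nonneg _) (Finset.mem_range.mpr hk)
      exact le_trans (le_trans (le_abs_self _) this) (le_max_right _ _)
    · exact le_trans (hcon k hk) (le_max_left _ _)
  obtain ⟨ψ, hψ, hψP⟩ := Filter.extraction_forall_of_frequently (fun n : ℕ => hfreq (n : ℝ))
  refine ⟨ψ, hψ, ?_⟩
  exact tendsto_atTop_mono (fun n => (hψP n).le) tendsto_natCast_atTop_atTop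

/-! ## B4 — the gap dichotomy along one common subsequence -/

/-- **B4.**  Finitely many real sequences admit ONE common subsequence along which each of them is either uniformly
bounded above or tends to `+∞`. [folklore: Bolzano–Weierstrass bookkeeping] -/
theorem gaps_dichotomy (K : ℕ) : ∀ (g : ℕ → Fin K → ℝ),
    ∃ φ : ℕ → ℕ, StrictMono φ ∧ ∃ B : ℝ, ∀ k,
      (∀ n, g (φ n) k ≤ B) ∨ Tendsto (fun n => g (φ n) k) atTop atTop := by
  induction K with
  | zero =>
    intro g
    exact ⟨id, strictMono_id, 0, fun k => k.elim0⟩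
  | succ K ih =>
    intro g
    obtain ⟨φ₁, hφ₁, B₁, h₁⟩ := ih (fun ν k => g ν k.castSucc)
    set u : ℕ → ℝ := fun n => g (φ₁ n) (Fin.last K) with hu
    by_cases hb : BddAbove (Set.range u)
    · obtain ⟨M, hM⟩ := hb
      refine ⟨φ₁, hφ₁, max B₁ M, fun k => ?_⟩
      rcases Fin.eq_castSucc_or_eq_last k with ⟨k', rfl⟩ | rfl
      · rcases h₁ k' with hbk | htk
        · exact Or.inl fun n => le_trans (hbk n) (le_max_left _ _)
        · exact Or.inr htk
      · exact Or.inl fun n => le_trans (hM ⟨n, rfl⟩) (le_max_right _ _)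
    · obtain ⟨ψ, hψ, hlim⟩ := exists_subseq_tendsto_atTop_of_not_bddAbove u hb
      refine ⟨φ₁ ∘ ψ, hφ₁.comp hψ, B₁, fun k => ?_⟩
      rcases Fin.eq_castSucc_or_eq_last k with ⟨k', rfl⟩ | rfl
      · rcases h₁ k' with hbk | htk
        · exact Or.inl fun n => hbk (ψ n)
        · exact Or.inr (htk.comp hψ.tendsto_atTop)
      · exact Or.inr hlim

/-- The gap dichotomy for the consecutive gaps of strictly increasing configurations (the form used for zero
clusters: `z ν` = the sorted zeros of the `ν`-th approximant). [folklore] -/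
theorem cluster_dichotomy {N : ℕ} (z : ℕ → Fin (N + 1) → ℝ) :
    ∃ φ : ℕ → ℕ, StrictMono φ ∧ ∃ B : ℝ, ∀ k : Fin N,
      (∀ n, z (φ n) k.succ - z (φ n) k.castSucc ≤ B) ∨
        Tendsto (fun n => z (φ n) k.succ - z (φ n) k.castSucc) atTop atTop :=
  gaps_dichotomy N (fun ν k => z ν k.succ - z ν k.castSucc)

/-- Bounded consecutive gaps on a run `i ≤ k < j` bound the diameter of the run. [folklore] -/
theorem telescoping_bound (u : ℕ → ℝ) (B : ℝ) (i : ℕ) :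
    ∀ j, i ≤ j → (∀ k, i ≤ k → k < j → u (k + 1) - u k ≤ B) → u j - u i ≤ (j - i : ℕ) * B := by
  intro j hij
  induction j, hij using Nat.le_induction with
  | base =>
    intro _
    simp
  | succ j hij ih =>
    intro hgap
    have h1 : u j - u i ≤ (j - i : ℕ) * B := ih fun k hk hkj => hgap k hk (Nat.lt_succ_of_lt hkj)
    have h2 : u (j + 1) - u j ≤ B := hgap j hij (Nat.lt_succ_self j)
    have h3 : ((j + 1 - i : ℕ) : ℝ) = ((j - i : ℕ) : ℝ) + 1 := by
      rw [Nat.succ_sub hij]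
      push_cast
      ring
    rw [h3]
    linarith

/-! ## B10a — a coincidence costs a value -/

/-- The `21` unordered index pairs. -/
theorem card_unorderedPairs :
    (Finset.univ.filter fun p : Fin 6 × Fin 6 => p.1 ≤ p.2).card = 21 := by decide

/-- Sorting a pair does not change `{i, j}`: distinct as ordered pairs in both orders ⇒ distinct sorted pairs. -/
theorem sortedPair_ne : ∀ i j k l : Fin 6, (i, j) ≠ (k, l) → (i, j) ≠ (l, k) →
    (min i j, max i j) ≠ (min k l, max k l) := by decide

/-- **B10a.**  If two different unordered pairs have the same sum then the pair sums take at most `20` values.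
[folklore] -/
theorem card_pairSums_le_twenty (δ : Fin 6 → ℝ)
    (h : ∃ i j k l : Fin 6, (i, j) ≠ (k, l) ∧ (i, j) ≠ (l, k) ∧ δ i + δ j = δ k + δ l) :
    (Finset.univ.image fun p : Fin 6 × Fin 6 => δ p.1 + δ p.2).card ≤ 20 := by
  classical
  obtain ⟨i, j, k, l, h1, h2, hsum⟩ := h
  set T : Finset (Fin 6 × Fin 6) := Finset.univ.filter fun p : Fin 6 × Fin 6 => p.1 ≤ p.2 with hT
  set f : Fin 6 × Fin 6 → ℝ := fun p => δ p.1 + δ p.2 with hf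
  set p₀ : Fin 6 × Fin 6 := (min i j, max i j) with hp₀
  set q₀ : Fin 6 × Fin 6 := (min k l, max k l) with hq₀
  have hpq : p₀ ≠ q₀ := sortedPair_ne i j k l h1 h2
  have hfmin : ∀ a b : Fin 6, f (min a b, max a b) = δ a + δ b := by
    intro a b
    simp only [hf]
    rcases le_total a b with hab | hab
    · rw [min_eq_left hab, max_eq_right hab]
    · rw [min_eq_right hab, max_eq_left hab, add_comm]
  have hfp : f p₀ = f q₀ := by rw [hp₀, hq₀, hfmin, hfmin, hsum]
  have hq₀T : q₀ ∈ T := by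
    rw [hT, Finset.mem_filter]
    exact ⟨Finset.mem_univ _, min_le_max⟩
  -- the image over all ordered pairs is the image over `T.erase p₀`
  have hsub : Finset.univ.image f ⊆ (T.erase p₀).image f := by
    intro y hy
    obtain ⟨⟨a, b⟩, _, rfl⟩ := Finset.mem_image.mp hy
    rw [Finset.mem_image]
    by_cases hab : (min a b, max a b) = p₀
    · refine ⟨q₀, Finset.mem_erase.mpr ⟨hpq.symm, hq₀T⟩, ?_⟩
      rw [← hfp, ← hab, hfmin]
    · refine ⟨(min a b, max a b), Finset.mem_erase.mpr ⟨hab, ?_⟩, hfmin a b⟩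
      rw [hT, Finset.mem_filter]
      exact ⟨Finset.mem_univ _, min_le_max⟩
  have hp₀T : p₀ ∈ T := by
    rw [hT, Finset.mem_filter]
    exact ⟨Finset.mem_univ _, min_le_max⟩
  calc (Finset.univ.image f).card ≤ ((T.erase p₀).image f).card := Finset.card_le_card hsub
    _ ≤ (T.erase p₀).card := Finset.card_image_le
    _ = T.card - 1 := Finset.card_erase_of_mem hp₀T
    _ = 20 := by rw [hT, card_unorderedPairs]


end Summit.ValiantsHypothesis.ValiantsHypothesis.Cruxes.DoorA26.WallBubbling.Assembly.Config

namespace Summit.ValiantsHypothesis.ValiantsHypothesis.Cruxes.DoorA26.WallBubbling.Assembly.Normalisation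

/-! # Part IV — verbatim copy of `Lines/wall_bubbling_Normalisation.lean` (B5, kernel-checked) -/


open Matrix Finset

/-- Polarisation of the `2 × 2` determinant (verbatim from the line file). -/
noncomputable def polar (S T : Matrix (Fin 2) (Fin 2) ℝ) : ℝ := ((S + T).det - S.det - T.det) / 2

/-- Realisable polar Gram matrices (verbatim from the line file). -/
def Realisable (G : Matrix (Fin 6) (Fin 6) ℝ) : Prop :=
  ∃ (ε : ℝ) (S : Fin 6 → Matrix (Fin 2) (Fin 2) ℝ), (ε = 1 ∨ ε = -1) ∧ (∀ l, (S l).IsSymm) ∧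
    ∀ i j, G i j = ε * polar (S i) (S j)

/-- Block sums over pair-sum value classes vanish (verbatim from the line file). -/
def BlockSumsZero (δ : Fin 6 → ℝ) (G : Matrix (Fin 6) (Fin 6) ℝ) : Prop :=
  ∀ v : ℝ, (∑ k, ∑ l, if δ k + δ l = v then G k l else 0) = 0

/-! ## B5a — the determinant of a `2 × 2` pencil is the polar double sum -/

/-- Entrywise formula for `polar` (no symmetry needed). -/
theorem polar_apply (S T : Matrix (Fin 2) (Fin 2) ℝ) :
    polar S T = (S 0 0 * T 1 1 + T 0 0 * S 1 1 - S 0 1 * T 1 0 - T 0 1 * S 1 0) / 2 := by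
  simp only [polar, Matrix.det_fin_two, Matrix.add_apply]
  ring

/-- `polar` is symmetric. -/
theorem polar_comm (S T : Matrix (Fin 2) (Fin 2) ℝ) : polar S T = polar T S := by
  rw [polar_apply, polar_apply]; ring

/-- `polar S S = det S`. -/
theorem polar_self (S : Matrix (Fin 2) (Fin 2) ℝ) : polar S S = S.det := by
  rw [polar_apply, Matrix.det_fin_two]; ring

/-- **B5a.**  `det (∑ₗ cₗ • Sₗ) = ∑ₖ ∑ₗ cₖ cₗ · polar Sₖ Sₗ` for any family of `2 × 2` real matrices. [folklore] -/
theorem det_sum_smul_fin_two {K : ℕ} (c : Fin K → ℝ) (S : Fin K → Matrix (Fin 2) (Fin 2) ℝ) :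
    (∑ l, c l • S l).det = ∑ k, ∑ l, c k * c l * polar (S k) (S l) := by
  -- right-hand side: split the symmetric summand into two mirror halves
  have hsplit : (∑ k, ∑ l, c k * c l * polar (S k) (S l))
      = (∑ k, ∑ l, c k * c l * (S k 0 0 * S l 1 1 - S k 0 1 * S l 1 0) / 2)
        + ∑ k, ∑ l, c k * c l * (S l 0 0 * S k 1 1 - S l 0 1 * S k 1 0) / 2 := by
    rw [← Finset.sum_add_distrib]
    refine Finset.sum_congr rfl fun k _ => ?_
    rw [← Finset.sum_add_distrib]
    refine Finset.sum_congr rfl fun l _ => ?_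
    rw [polar_apply]
    ring
  have hmirror : (∑ k, ∑ l, c k * c l * (S l 0 0 * S k 1 1 - S l 0 1 * S k 1 0) / 2)
      = ∑ k, ∑ l, c k * c l * (S k 0 0 * S l 1 1 - S k 0 1 * S l 1 0) / 2 := by
    rw [Finset.sum_comm]
    refine Finset.sum_congr rfl fun k _ => Finset.sum_congr rfl fun l _ => ?_
    ring
  rw [hsplit, hmirror, ← two_mul, Finset.mul_sum]
  simp_rw [Finset.mul_sum]
  -- left-hand side
  rw [Matrix.det_fin_two]
  simp only [Matrix.sum_apply, Matrix.smul_apply, smul_eq_mul]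
  rw [Finset.sum_mul_sum, Finset.sum_mul_sum, ← Finset.sum_sub_distrib]
  refine Finset.sum_congr rfl fun k _ => ?_
  rw [← Finset.sum_sub_distrib]
  refine Finset.sum_congr rfl fun l _ => ?_
  ring

/-! ## B5b — real-exponent pencils -/

/-- **B5b.**  For `0 < x`: `det (∑ₗ x^{δₗ} • Sₗ) = ∑ₖ ∑ₗ polar Sₖ Sₗ · x^{δₖ + δₗ}`. [folklore] -/
theorem det_rpow_pencil {K : ℕ} (δ : Fin K → ℝ) (S : Fin K → Matrix (Fin 2) (Fin 2) ℝ) {x : ℝ} (hx : 0 < x) :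
    (∑ l, (x ^ (δ l)) • S l).det = ∑ k, ∑ l, polar (S k) (S l) * x ^ (δ k + δ l) := by
  rw [det_sum_smul_fin_two]
  refine Finset.sum_congr rfl fun k _ => Finset.sum_congr rfl fun l _ => ?_
  rw [Real.rpow_add hx]
  ring

/-! ## B5c — regrouping by pair-sum values -/

/-- **B5c.**  Regrouping a pair sum by the VALUES of `δₖ + δₗ`: the coefficient of `φ v` is the block sum of the value
class `v` (the quantity in `BlockSumsZero`). [folklore] -/
theorem sum_pairs_eq_sum_values {K : ℕ} (δ : Fin K → ℝ) (G : Matrix (Fin K) (Fin K) ℝ) (φ : ℝ → ℝ) :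
    (∑ k, ∑ l, G k l * φ (δ k + δ l))
      = ∑ v ∈ Finset.univ.image (fun p : Fin K × Fin K => δ p.1 + δ p.2),
          (∑ k, ∑ l, if δ k + δ l = v then G k l else 0) * φ v := by
  classical
  set V := Finset.univ.image (fun p : Fin K × Fin K => δ p.1 + δ p.2) with hV
  -- pass to the product index
  have hL : (∑ k, ∑ l, G k l * φ (δ k + δ l)) = ∑ p : Fin K × Fin K, G p.1 p.2 * φ (δ p.1 + δ p.2) := by
    rw [← Finset.sum_product']
    rfl
  have hR : ∀ v, (∑ k, ∑ l, if δ k + δ l = v then G k l else 0)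
      = ∑ p : Fin K × Fin K, if δ p.1 + δ p.2 = v then G p.1 p.2 else 0 := by
    intro v
    rw [← Finset.sum_product']
    rfl
  rw [hL]
  simp_rw [hR]
  -- fiberwise regrouping over the image
  rw [← Finset.sum_fiberwise_of_maps_to (s := (Finset.univ : Finset (Fin K × Fin K))) (t := V)
    (g := fun p : Fin K × Fin K => δ p.1 + δ p.2)
    (fun p hp => Finset.mem_image_of_mem _ hp)]
  refine Finset.sum_congr rfl fun v _ => ?_
  rw [Finset.sum_mul, Finset.sum_filter]
  refine Finset.sum_congr rfl fun p _ => ?_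
  split_ifs with h
  · rw [h]
  · rw [zero_mul]

/-- **B5a–c combined.**  The pencil determinant as a real-exponent polynomial over the pair-sum values, with the block sums
of the polar Gram matrix `G_S = (polar Sₖ Sₗ)` as coefficients. [folklore] -/
theorem det_rpow_pencil_eq_valueSum {K : ℕ} (δ : Fin K → ℝ) (S : Fin K → Matrix (Fin 2) (Fin 2) ℝ) {x : ℝ}
    (hx : 0 < x) :
    (∑ l, (x ^ (δ l)) • S l).det
      = ∑ v ∈ Finset.univ.image (fun p : Fin K × Fin K => δ p.1 + δ p.2),
          (∑ k, ∑ l, if δ k + δ l = v then polar (S k) (S l) else 0) * x ^ v := by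
  rw [det_rpow_pencil δ S hx]
  exact sum_pairs_eq_sum_values δ (Matrix.of fun k l => polar (S k) (S l)) (fun v => x ^ v)

/-- If all block sums vanish, the pencil determinant vanishes identically on `(0, ∞)` (so such `G_S` never come from a
point of the twenty-locus — used contrapositively in B12: the normalised limit pattern is a blow-up pattern). -/
theorem det_rpow_pencil_eq_zero_of_blockSums {K : ℕ} (δ : Fin K → ℝ) (S : Fin K → Matrix (Fin 2) (Fin 2) ℝ)
    (h : ∀ v : ℝ, (∑ k, ∑ l, if δ k + δ l = v then polar (S k) (S l) else 0) = 0) {x : ℝ} (hx : 0 < x) :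
    (∑ l, (x ^ (δ l)) • S l).det = 0 := by
  rw [det_rpow_pencil_eq_valueSum δ S hx]
  exact Finset.sum_eq_zero fun v _ => by rw [h v, zero_mul]

/-! ## B5d — positive zeros versus real zeros under `x = exp t` -/

/-- The positive zero set of `F` is the `exp`-image of the real zero set of `F ∘ exp`. -/
theorem zeros_pos_eq_image_exp (F : ℝ → ℝ) :
    {x : ℝ | 0 < x ∧ F x = 0} = Real.exp '' {t : ℝ | F (Real.exp t) = 0} := by
  ext x
  constructor
  · rintro ⟨hx, hF⟩
    exact ⟨Real.log x, by rw [Set.mem_setOf_eq, Real.exp_log hx]; exact hF, Real.exp_log hx⟩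
  · rintro ⟨t, ht, rfl⟩
    exact ⟨Real.exp_pos t, ht⟩

/-- **B5d.**  Counting positive zeros of `F` = counting real zeros of `F ∘ exp`. [folklore] -/
theorem ncard_zeros_pos_eq (F : ℝ → ℝ) :
    {x : ℝ | 0 < x ∧ F x = 0}.ncard = {t : ℝ | F (Real.exp t) = 0}.ncard := by
  rw [zeros_pos_eq_image_exp, Set.ncard_image_of_injective _ Real.exp_injective]

/-- `x ^ v` along `x = exp t` is `exp (v t)`. -/
theorem rpow_exp_eq (v t : ℝ) : (Real.exp t) ^ v = Real.exp (v * t) := by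
  rw [← Real.exp_mul, mul_comm]

/-! ## B5e–f — the polar Gram matrix is realisable; scaling -/

/-- **B5e.**  The polar Gram matrix of six symmetric letters is realisable (`ε = 1`). -/
theorem realisable_polarGram (S : Fin 6 → Matrix (Fin 2) (Fin 2) ℝ) (hS : ∀ l, (S l).IsSymm) :
    Realisable (Matrix.of fun k l => polar (S k) (S l)) :=
  ⟨1, S, Or.inl rfl, hS, fun i j => by rw [Matrix.of_apply, one_mul]⟩

/-- `polar` is homogeneous: `polar (a • S) (a • T) = a² · polar S T`. -/
theorem polar_smul_smul (a : ℝ) (S T : Matrix (Fin 2) (Fin 2) ℝ) :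
    polar (a • S) (a • T) = a * a * polar S T := by
  rw [polar_apply, polar_apply]
  simp only [Matrix.smul_apply, smul_eq_mul]
  ring

/-- **B5f.**  The realisable cone is invariant under ALL real scalings (`c ≥ 0`: rescale the letters by `√c`;
`c < 0`: also flip `ε`).  In particular the normalisation `G / ‖G‖` of B12 stays realisable. [folklore] -/
theorem realisable_smul (c : ℝ) {G : Matrix (Fin 6) (Fin 6) ℝ} (hG : Realisable G) : Realisable (c • G) := by
  obtain ⟨ε, S, hε, hS, hG⟩ := hG
  have hsymm : ∀ (a : ℝ) l, (a • S l).IsSymm := fun a l => (hS l).smul a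
  rcases le_or_gt 0 c with hc | hc
  · refine ⟨ε, fun l => Real.sqrt c • S l, hε, hsymm _, fun i j => ?_⟩
    rw [Matrix.smul_apply, smul_eq_mul, hG i j, polar_smul_smul, Real.mul_self_sqrt hc]
    ring
  · refine ⟨-ε, fun l => Real.sqrt (-c) • S l, ?_, hsymm _, fun i j => ?_⟩
    · rcases hε with rfl | rfl
      · right; rfl
      · left; norm_num
    · rw [Matrix.smul_apply, smul_eq_mul, hG i j, polar_smul_smul, Real.mul_self_sqrt (by linarith)]
      ring

/-- Block sums are linear: scaling preserves `BlockSumsZero`. -/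
theorem blockSumsZero_smul (δ : Fin 6 → ℝ) (c : ℝ) {G : Matrix (Fin 6) (Fin 6) ℝ} (hG : BlockSumsZero δ G) :
    BlockSumsZero δ (c • G) := by
  intro v
  have h := hG v
  have : (∑ k, ∑ l, if δ k + δ l = v then (c • G) k l else 0)
      = c * ∑ k, ∑ l, if δ k + δ l = v then G k l else 0 := by
    rw [Finset.mul_sum]
    refine Finset.sum_congr rfl fun k _ => ?_
    rw [Finset.mul_sum]
    refine Finset.sum_congr rfl fun l _ => ?_
    split_ifs <;> simp [Matrix.smul_apply]
  rw [this, h, mul_zero]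

/-- Block sums pass to entrywise limits (the `BlockSumsZero` half of the bubbling limit in B12 is a limit of linear
identities). -/
theorem blockSum_tendsto (δ : Fin 6 → ℝ) (v : ℝ) {Gseq : ℕ → Matrix (Fin 6) (Fin 6) ℝ} {G : Matrix (Fin 6) (Fin 6) ℝ}
    (hlim : Filter.Tendsto Gseq Filter.atTop (nhds G)) :
    Filter.Tendsto (fun ν => ∑ k, ∑ l, if δ k + δ l = v then Gseq ν k l else 0) Filter.atTop
      (nhds (∑ k, ∑ l, if δ k + δ l = v then G k l else 0)) := by
  refine tendsto_finsetSum _ fun k _ => tendsto_finsetSum _ fun l _ => ?_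
  split_ifs
  · exact ((continuous_apply l).comp (continuous_apply k)).continuousAt.tendsto.comp hlim
  · exact tendsto_const_nhds


end Summit.ValiantsHypothesis.ValiantsHypothesis.Cruxes.DoorA26.WallBubbling.Assembly.Normalisation

namespace Summit.ValiantsHypothesis.ValiantsHypothesis.Cruxes.DoorA26.WallBubbling.Assembly.Inertia

/-! # Part V — verbatim copy of `Lines/wall_bubbling_Inertia.lean` (B11, kernel-checked) -/


open Matrix Finset

variable {n : Type*} [Fintype n] [DecidableEq n]

/-- Symmetroid Gram shape: `M = v vᵀ − u uᵀ − w wᵀ` (signature `≤ (1,2)`, rank `≤ 3`). [folklore] -/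
def IsSymGram (M : Matrix n n ℝ) : Prop :=
  ∃ v u w : n → ℝ, M = vecMulVec v v - vecMulVec u u - vecMulVec w w

/-- `n₊(M) ≥ 2`, witness-style (two `M`-orthogonal vectors of positive `M`-norm). [folklore] -/
def TwoPos (M : Matrix n n ℝ) : Prop :=
  ∃ x y : n → ℝ, 0 < x ⬝ᵥ (M *ᵥ x) ∧ 0 < y ⬝ᵥ (M *ᵥ y) ∧ x ⬝ᵥ (M *ᵥ y) = 0

/-- `n₋(M) ≥ 3`, witness-style (three pairwise `M`-orthogonal vectors of negative `M`-norm). [folklore] -/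
def ThreeNeg (M : Matrix n n ℝ) : Prop :=
  ∃ x y z : n → ℝ, x ⬝ᵥ (M *ᵥ x) < 0 ∧ y ⬝ᵥ (M *ᵥ y) < 0 ∧ z ⬝ᵥ (M *ᵥ z) < 0 ∧
    x ⬝ᵥ (M *ᵥ y) = 0 ∧ x ⬝ᵥ (M *ᵥ z) = 0 ∧ y ⬝ᵥ (M *ᵥ z) = 0

/-! ## The real spectral theorem in coordinates -/

omit [Fintype n] [DecidableEq n] in
/-- A real symmetric matrix is Hermitian. -/
theorem isHermitian_of_isSymm {M : Matrix n n ℝ} (hM : M.IsSymm) : M.IsHermitian := by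
  show Mᴴ = M
  rw [Matrix.conjTranspose_eq_transpose_of_trivial]
  exact hM

/-- Entrywise spectral expansion `M a b = ∑ i, λ i · u i a · u i b`. [folklore] -/
theorem entry_eq_sum_eigen {M : Matrix n n ℝ} (hH : M.IsHermitian) (a b : n) :
    M a b = ∑ i, hH.eigenvalues i * ((⇑(hH.eigenvectorBasis i)) a * (⇑(hH.eigenvectorBasis i)) b) := by
  have h := hH.spectral_theorem
  rw [Unitary.conjStarAlgAut_apply] at h
  conv_lhs => rw [h]
  rw [Matrix.mul_apply]
  simp only [Matrix.mul_apply, Matrix.diagonal_apply, Matrix.star_apply, Matrix.IsHermitian.eigenvectorUnitary_apply,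
    Function.comp_apply, star_trivial, mul_ite, mul_zero, Finset.sum_ite_eq', Finset.mem_univ, if_true]
  refine Finset.sum_congr rfl fun i _ => ?_
  simp only [RCLike.ofReal_real_eq_id, id_eq]
  ring

/-- Orthonormality of the eigenvector basis in `dotProduct` form. [folklore] -/
theorem dot_eigen {M : Matrix n n ℝ} (hH : M.IsHermitian) (i j : n) :
    (⇑(hH.eigenvectorBasis i)) ⬝ᵥ (⇑(hH.eigenvectorBasis j)) = if i = j then 1 else 0 := by
  have h := (orthonormal_iff_ite.mp hH.eigenvectorBasis.orthonormal) i j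
  rw [EuclideanSpace.inner_eq_star_dotProduct, star_trivial, dotProduct_comm] at h
  exact_mod_cast h

/-- The quadratic form is diagonal in the eigenvector basis. [folklore] -/
theorem quad_eigen {M : Matrix n n ℝ} (hH : M.IsHermitian) (i j : n) :
    (⇑(hH.eigenvectorBasis i)) ⬝ᵥ (M *ᵥ ⇑(hH.eigenvectorBasis j)) = if i = j then hH.eigenvalues j else 0 := by
  rw [hH.mulVec_eigenvectorBasis j, dotProduct_smul, dot_eigen hH i j]
  split_ifs <;> simp

/-! ## Padding small sums of rank-one terms -/

omit [Fintype n] in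
/-- A sum of at most one rank-one square minus a sum of at most two is of symmetroid Gram shape. [folklore] -/
theorem isSymGram_of_small_sums (f g : n → n → ℝ) (P N : Finset n) (hP : P.card ≤ 1) (hN : N.card ≤ 2) :
    ∃ v u w : n → ℝ, (∑ i ∈ P, vecMulVec (f i) (f i)) - ∑ i ∈ N, vecMulVec (g i) (g i) =
      vecMulVec v v - vecMulVec u u - vecMulVec w w := by
  -- the positive part
  have hPsum : ∃ v : n → ℝ, ∑ i ∈ P, vecMulVec (f i) (f i) = vecMulVec v v := by
    rcases Nat.le_one_iff_eq_zero_or_eq_one.mp hP with h0 | h1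
    · refine ⟨0, ?_⟩
      rw [Finset.card_eq_zero.mp h0, Finset.sum_empty]
      ext a b
      simp
    · obtain ⟨p, rfl⟩ := Finset.card_eq_one.mp h1
      exact ⟨f p, by rw [Finset.sum_singleton]⟩
  -- the negative part
  have hNsum : ∃ u w : n → ℝ, ∑ i ∈ N, vecMulVec (g i) (g i) = vecMulVec u u + vecMulVec w w := by
    have hN' : N.card = 0 ∨ N.card = 1 ∨ N.card = 2 := by omega
    rcases hN' with h0 | h1 | h2
    · refine ⟨0, 0, ?_⟩
      rw [Finset.card_eq_zero.mp h0, Finset.sum_empty]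
      ext a b
      simp
    · obtain ⟨q, rfl⟩ := Finset.card_eq_one.mp h1
      refine ⟨g q, 0, ?_⟩
      rw [Finset.sum_singleton]
      ext a b
      simp
    · obtain ⟨q, r, hqr, rfl⟩ := Finset.card_eq_two.mp h2
      exact ⟨g q, g r, by rw [Finset.sum_pair hqr]⟩
  obtain ⟨v, hv⟩ := hPsum
  obtain ⟨u, w, huw⟩ := hNsum
  exact ⟨v, u, w, by rw [hv, huw, sub_add_eq_sub_sub]⟩

/-! ## B11 (spectral half): inertia `≤ (1,2)` ⇒ symmetroid Gram shape -/

omit [DecidableEq n] in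
/-- **B11, spectral half.**  A real symmetric matrix with `n₊ ≤ 1` and `n₋ ≤ 2` (witness-style negations) is of the shape
`v vᵀ − u uᵀ − w wᵀ`. [folklore: spectral theorem] -/
theorem isSymGram_of_inertia (M : Matrix n n ℝ) (hM : M.IsSymm) (h2 : ¬ TwoPos M) (h3 : ¬ ThreeNeg M) :
    IsSymGram M := by
  classical
  have hH : M.IsHermitian := isHermitian_of_isSymm hM
  set lam : n → ℝ := hH.eigenvalues with hlam
  set u : n → n → ℝ := fun i => ⇑(hH.eigenvectorBasis i) with hu
  have hquad : ∀ i j, u i ⬝ᵥ (M *ᵥ u j) = if i = j then lam j else 0 := fun i j => quad_eigen hH i j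
  -- at most one positive eigenvalue
  set P : Finset n := Finset.univ.filter fun i => 0 < lam i with hPdef
  set N : Finset n := Finset.univ.filter fun i => lam i < 0 with hNdef
  have hPcard : P.card ≤ 1 := by
    by_contra hc
    obtain ⟨i, j, hi, hj, hij⟩ := (Finset.one_lt_card_iff (s := P)).mp (by omega)
    have hi' : 0 < lam i := (Finset.mem_filter.mp hi).2
    have hj' : 0 < lam j := (Finset.mem_filter.mp hj).2
    apply h2
    refine ⟨u i, u j, ?_, ?_, ?_⟩
    · rw [hquad, if_pos rfl]; exact hi'
    · rw [hquad, if_pos rfl]; exact hj'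
    · rw [hquad, if_neg hij]
  have hNcard : N.card ≤ 2 := by
    by_contra hc
    obtain ⟨i, j, k, hi, hj, hk, hij, hik, hjk⟩ := (Finset.two_lt_card_iff (s := N)).mp (by omega)
    have hi' : lam i < 0 := (Finset.mem_filter.mp hi).2
    have hj' : lam j < 0 := (Finset.mem_filter.mp hj).2
    have hk' : lam k < 0 := (Finset.mem_filter.mp hk).2
    apply h3
    refine ⟨u i, u j, u k, ?_, ?_, ?_, ?_, ?_, ?_⟩
    · rw [hquad, if_pos rfl]; exact hi'
    · rw [hquad, if_pos rfl]; exact hj'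
    · rw [hquad, if_pos rfl]; exact hk'
    · rw [hquad, if_neg hij]
    · rw [hquad, if_neg hik]
    · rw [hquad, if_neg hjk]
  -- the rank-one expansion split by sign
  set f : n → n → ℝ := fun i => Real.sqrt (lam i) • u i with hf
  set g : n → n → ℝ := fun i => Real.sqrt (-lam i) • u i with hg
  have hM_eq : M = (∑ i ∈ P, vecMulVec (f i) (f i)) - ∑ i ∈ N, vecMulVec (g i) (g i) := by
    ext a b
    rw [entry_eq_sum_eigen hH a b, Matrix.sub_apply, Matrix.sum_apply, Matrix.sum_apply, hPdef, hNdef,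
      Finset.sum_filter, Finset.sum_filter, ← Finset.sum_sub_distrib]
    refine Finset.sum_congr rfl fun i _ => ?_
    have key : lam i * (u i a * u i b) =
        (if 0 < lam i then f i a * f i b else 0) - (if lam i < 0 then g i a * g i b else 0) := by
      simp only [hf, hg, Pi.smul_apply, smul_eq_mul]
      rcases lt_trichotomy (lam i) 0 with hneg | hzero | hpos
      · rw [if_neg (not_lt.mpr hneg.le), if_pos hneg]
        have hs : Real.sqrt (-lam i) * Real.sqrt (-lam i) = -lam i := Real.mul_self_sqrt (by linarith)
        have hr : Real.sqrt (-lam i) * u i a * (Real.sqrt (-lam i) * u i b)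
            = (Real.sqrt (-lam i) * Real.sqrt (-lam i)) * (u i a * u i b) := by ring
        rw [hr, hs]
        ring
      · rw [if_neg (by rw [hzero]; exact lt_irrefl 0), if_neg (by rw [hzero]; exact lt_irrefl 0), hzero]
        ring
      · rw [if_pos hpos, if_neg (not_lt.mpr hpos.le)]
        have hs : Real.sqrt (lam i) * Real.sqrt (lam i) = lam i := Real.mul_self_sqrt hpos.le
        have hr : Real.sqrt (lam i) * u i a * (Real.sqrt (lam i) * u i b)
            = (Real.sqrt (lam i) * Real.sqrt (lam i)) * (u i a * u i b) := by ring
        rw [hr, hs]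
        ring
    simp only [vecMulVec_apply]
    exact key
  obtain ⟨v, u', w, hvuw⟩ := isSymGram_of_small_sums f g P N hPcard hNcard
  exact ⟨v, u', w, by rw [hM_eq, hvuw]⟩

/-! ## The converse: symmetroid Gram shape ⇒ inertia `≤ (1,2)` -/

omit [DecidableEq n] in
/-- Bilinear form of a rank-one matrix. [folklore] -/
theorem dot_vecMulVec_mulVec (a b z₁ z₂ : n → ℝ) :
    z₁ ⬝ᵥ ((vecMulVec a b) *ᵥ z₂) = (z₁ ⬝ᵥ a) * (z₂ ⬝ᵥ b) := by
  rw [Matrix.vecMulVec_mulVec, op_smul_eq_smul, dotProduct_smul, smul_eq_mul, dotProduct_comm z₂ b]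
  ring

omit [DecidableEq n] in
/-- Bilinear form of `v vᵀ − u uᵀ − w wᵀ`. [folklore] -/
theorem symGram_form (v u w z₁ z₂ : n → ℝ) :
    z₁ ⬝ᵥ ((vecMulVec v v - vecMulVec u u - vecMulVec w w) *ᵥ z₂)
      = (z₁ ⬝ᵥ v) * (z₂ ⬝ᵥ v) - (z₁ ⬝ᵥ u) * (z₂ ⬝ᵥ u) - (z₁ ⬝ᵥ w) * (z₂ ⬝ᵥ w) := by
  simp only [Matrix.sub_mulVec, dotProduct_sub, dot_vecMulVec_mulVec]

omit [DecidableEq n] in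
/-- `n₊ ≤ 1` for symmetroid Grams (the tree's `onePositive`, any index type). [folklore] -/
theorem not_twoPos_of_isSymGram {M : Matrix n n ℝ} (hM : IsSymGram M) : ¬ TwoPos M := by
  obtain ⟨v, u, w, rfl⟩ := hM
  rintro ⟨x, y, hx, hy, hxy⟩
  rw [symGram_form] at hx hy hxy
  set α := x ⬝ᵥ v
  set β := y ⬝ᵥ v
  set p := x ⬝ᵥ u
  set p' := y ⬝ᵥ u
  set s := x ⬝ᵥ w
  set s' := y ⬝ᵥ w
  have hα : 0 < α * α := by nlinarith [mul_self_nonneg p, mul_self_nonneg s]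
  have h2 : β * β * (α * α - p * p - s * s) + α * α * (β * β - p' * p' - s' * s')
      = -((β * p - α * p') ^ 2 + (β * s - α * s') ^ 2) := by
    linear_combination (2 * α * β) * hxy
  nlinarith [mul_pos hα hy, mul_nonneg (mul_self_nonneg β) hx.le, sq_nonneg (β * p - α * p'),
    sq_nonneg (β * s - α * s')]

omit [DecidableEq n] in
/-- `n₋ ≤ 2` for symmetroid Grams: three pairwise orthogonal negative vectors of the form `(+,−,−)` would have a
Gram determinant `n₁ n₂ n₃ < 0`, but that determinant is `det(T)² · det diag(1,−1,−1) ≥ 0`. [folklore] -/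
theorem not_threeNeg_of_isSymGram {M : Matrix n n ℝ} (hM : IsSymGram M) : ¬ ThreeNeg M := by
  obtain ⟨v, u, w, rfl⟩ := hM
  rintro ⟨x, y, z, hx, hy, hz, hxy, hxz, hyz⟩
  rw [symGram_form] at hx hy hz hxy hxz hyz
  set a1 := x ⬝ᵥ v
  set a2 := y ⬝ᵥ v
  set a3 := z ⬝ᵥ v
  set p1 := x ⬝ᵥ u
  set p2 := y ⬝ᵥ u
  set p3 := z ⬝ᵥ u
  set s1 := x ⬝ᵥ w
  set s2 := y ⬝ᵥ w
  set s3 := z ⬝ᵥ w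
  set D := a1 * p2 * s3 - a1 * p3 * s2 - a2 * p1 * s3 + a2 * p3 * s1 + a3 * p1 * s2 - a3 * p2 * s1 with hD
  have key : (a1 * a1 - p1 * p1 - s1 * s1) * (a2 * a2 - p2 * p2 - s2 * s2) * (a3 * a3 - p3 * p3 - s3 * s3)
      - (a1 * a1 - p1 * p1 - s1 * s1) * (a2 * a3 - p2 * p3 - s2 * s3) ^ 2
      - (a2 * a2 - p2 * p2 - s2 * s2) * (a1 * a3 - p1 * p3 - s1 * s3) ^ 2
      - (a3 * a3 - p3 * p3 - s3 * s3) * (a1 * a2 - p1 * p2 - s1 * s2) ^ 2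
      + 2 * (a1 * a2 - p1 * p2 - s1 * s2) * (a1 * a3 - p1 * p3 - s1 * s3) * (a2 * a3 - p2 * p3 - s2 * s3)
      = D ^ 2 := by
    rw [hD]; ring
  rw [hxy, hxz, hyz] at key
  have h12 : 0 < (a1 * a1 - p1 * p1 - s1 * s1) * (a2 * a2 - p2 * p2 - s2 * s2) := mul_pos_of_neg_of_neg hx hy
  have h123 : (a1 * a1 - p1 * p1 - s1 * s1) * (a2 * a2 - p2 * p2 - s2 * s2) * (a3 * a3 - p3 * p3 - s3 * s3) < 0 :=
    mul_neg_of_pos_of_neg h12 hz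
  nlinarith [sq_nonneg D]

/-! ## Topology: `TwoPos`, `ThreeNeg` are open; symmetroid Gram shape is closed -/

omit [DecidableEq n] in
/-- Continuity of `M ↦ f(M)ᵀ M g(M)` for continuous vector fields `f, g`. -/
theorem continuous_form {f g : Matrix n n ℝ → (n → ℝ)} (hf : Continuous f) (hg : Continuous g) :
    Continuous fun M : Matrix n n ℝ => f M ⬝ᵥ (M *ᵥ g M) :=
  hf.dotProduct (continuous_id.matrix_mulVec hg)

omit [DecidableEq n] in
/-- **`TwoPos` is open** (re-orthogonalise the witness without dividing: `y″ = q(x) y − b(x,y) x`). [folklore] -/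
theorem isOpen_twoPos : IsOpen {M : Matrix n n ℝ | TwoPos M} := by
  rw [isOpen_iff_mem_nhds]
  rintro M₀ ⟨x, y, hx, hy, hxy⟩
  -- the moving witness
  let Y : Matrix n n ℝ → (n → ℝ) := fun M => (x ⬝ᵥ (M *ᵥ x)) • y - (x ⬝ᵥ (M *ᵥ y)) • x
  have hYc : Continuous Y :=
    ((continuous_form continuous_const continuous_const).smul continuous_const).sub
      ((continuous_form continuous_const continuous_const).smul continuous_const)
  let U : Set (Matrix n n ℝ) := {M | 0 < x ⬝ᵥ (M *ᵥ x) ∧ 0 < Y M ⬝ᵥ (M *ᵥ Y M)}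
  have hUopen : IsOpen U :=
    (isOpen_lt continuous_const (continuous_form continuous_const continuous_const)).inter
      (isOpen_lt continuous_const (continuous_form hYc hYc))
  have hY₀ : Y M₀ = (x ⬝ᵥ (M₀ *ᵥ x)) • y := by
    simp only [Y, hxy, zero_smul, sub_zero]
  have hM₀U : M₀ ∈ U := by
    refine ⟨hx, ?_⟩
    rw [hY₀, Matrix.mulVec_smul, dotProduct_smul, smul_dotProduct, smul_eq_mul, smul_eq_mul]
    exact mul_pos hx (mul_pos hx hy)
  refine Filter.mem_of_superset (hUopen.mem_nhds hM₀U) ?_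
  rintro M ⟨hMx, hMY⟩
  refine ⟨x, Y M, hMx, hMY, ?_⟩
  simp only [Y, Matrix.mulVec_sub, Matrix.mulVec_smul, dotProduct_sub, dotProduct_smul, smul_eq_mul]
  ring

omit [DecidableEq n] in
/-- **`ThreeNeg` is open** (two-step re-orthogonalisation without dividing). [folklore] -/
theorem isOpen_threeNeg : IsOpen {M : Matrix n n ℝ | ThreeNeg M} := by
  rw [isOpen_iff_mem_nhds]
  rintro M₀ ⟨x, y, z, hx, hy, hz, hxy, hxz, hyz⟩
  -- abbreviations for the forms
  let q : Matrix n n ℝ → (n → ℝ) → ℝ := fun M a => a ⬝ᵥ (M *ᵥ a)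
  let b : Matrix n n ℝ → (n → ℝ) → (n → ℝ) → ℝ := fun M a c => a ⬝ᵥ (M *ᵥ c)
  -- moving witnesses
  let Y : Matrix n n ℝ → (n → ℝ) := fun M => (q M x) • y - (b M x y) • x
  let C : Matrix n n ℝ → ℝ := fun M => -((q M x) * (b M (Y M) z) - (b M x z) * (b M (Y M) x))
  let Z : Matrix n n ℝ → (n → ℝ) := fun M => ((q M x) * (q M (Y M))) • z - ((b M x z) * (q M (Y M))) • x + (C M) • Y M
  have hq : ∀ a : n → ℝ, Continuous fun M => q M a := fun a => continuous_form continuous_const continuous_const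
  have hb : ∀ a c : n → ℝ, Continuous fun M => b M a c := fun a c => continuous_form continuous_const continuous_const
  have hYc : Continuous Y := ((hq x).smul continuous_const).sub ((hb x y).smul continuous_const)
  have hbY : ∀ c : n → ℝ, Continuous fun M => b M (Y M) c := fun c => continuous_form hYc continuous_const
  have hqY : Continuous fun M => q M (Y M) := continuous_form hYc hYc
  have hCc : Continuous C := (((hq x).mul (hbY z)).sub ((hb x z).mul (hbY x))).neg
  have hZc : Continuous Z :=
    ((((hq x).mul hqY).smul continuous_const).sub (((hb x z).mul hqY).smul continuous_const)).add (hCc.smul hYc)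
  let U : Set (Matrix n n ℝ) := {M | q M x < 0 ∧ q M (Y M) < 0 ∧ q M (Z M) < 0}
  have hUopen : IsOpen U :=
    (isOpen_lt (hq x) continuous_const).inter
      ((isOpen_lt hqY continuous_const).inter (isOpen_lt (continuous_form hZc hZc) continuous_const))
  -- values at `M₀`
  have hY₀ : Y M₀ = (q M₀ x) • y := by
    simp only [Y, b, hxy, zero_smul, sub_zero]
  have hqY₀ : q M₀ (Y M₀) = (q M₀ x) * ((q M₀ x) * q M₀ y) := by
    simp only [q, hY₀, Matrix.mulVec_smul, dotProduct_smul, smul_dotProduct, smul_eq_mul]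
  have hbYz₀ : b M₀ (Y M₀) z = 0 := by
    simp only [b, hY₀, smul_dotProduct, smul_eq_mul]
    rw [show y ⬝ᵥ (M₀ *ᵥ z) = 0 from hyz, mul_zero]
  have hC₀ : C M₀ = 0 := by
    simp only [C, hbYz₀, mul_zero, zero_sub, neg_neg]
    rw [show b M₀ x z = 0 from hxz, zero_mul]
  have hZ₀ : Z M₀ = ((q M₀ x) * (q M₀ (Y M₀))) • z := by
    simp only [Z, hC₀, zero_smul, add_zero]
    rw [show b M₀ x z = 0 from hxz, zero_mul, zero_smul, sub_zero]
  have hqx₀ : q M₀ x < 0 := hx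
  have hqY₀neg : q M₀ (Y M₀) < 0 := by
    rw [hqY₀]
    have : 0 < q M₀ x * q M₀ x := mul_pos_of_neg_of_neg hqx₀ hqx₀
    nlinarith [this, hy]
  have hM₀U : M₀ ∈ U := by
    refine ⟨hqx₀, hqY₀neg, ?_⟩
    show Z M₀ ⬝ᵥ (M₀ *ᵥ Z M₀) < 0
    rw [hZ₀, Matrix.mulVec_smul, dotProduct_smul, smul_dotProduct, smul_eq_mul, smul_eq_mul]
    have hApos : 0 < q M₀ x * q M₀ (Y M₀) := mul_pos_of_neg_of_neg hqx₀ hqY₀neg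
    have hA : 0 < (q M₀ x * q M₀ (Y M₀)) * (q M₀ x * q M₀ (Y M₀)) := mul_pos hApos hApos
    have hz' : z ⬝ᵥ (M₀ *ᵥ z) < 0 := hz
    nlinarith [hA, hz']
  refine Filter.mem_of_superset (hUopen.mem_nhds hM₀U) ?_
  rintro M ⟨hMx, hMY, hMZ⟩
  refine ⟨x, Y M, Z M, hMx, hMY, hMZ, ?_, ?_, ?_⟩
  · simp only [Y, q, b, Matrix.mulVec_sub, Matrix.mulVec_smul, dotProduct_sub, dotProduct_smul, smul_eq_mul]
    ring
  · simp only [Z, Y, C, q, b, Matrix.mulVec_sub, Matrix.mulVec_add, Matrix.mulVec_smul, dotProduct_sub,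
      dotProduct_add, dotProduct_smul, smul_eq_mul]
    ring
  · simp only [Z, C, q, b, Matrix.mulVec_sub, Matrix.mulVec_add, Matrix.mulVec_smul, dotProduct_sub,
      dotProduct_add, dotProduct_smul, smul_eq_mul]
    ring

omit [DecidableEq n] in
/-- **B11, characterisation.**  `IsSymGram M ↔ M.IsSymm ∧ ¬ TwoPos M ∧ ¬ ThreeNeg M`. [folklore: Sylvester] -/
theorem isSymGram_iff (M : Matrix n n ℝ) : IsSymGram M ↔ M.IsSymm ∧ ¬ TwoPos M ∧ ¬ ThreeNeg M := by
  constructor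
  · intro h
    refine ⟨?_, not_twoPos_of_isSymGram h, not_threeNeg_of_isSymGram h⟩
    obtain ⟨v, u, w, rfl⟩ := h
    unfold Matrix.IsSymm
    ext a b
    simp only [Matrix.transpose_apply, Matrix.sub_apply, vecMulVec_apply]
    ring
  · rintro ⟨h1, h2, h3⟩
    exact isSymGram_of_inertia M h1 h2 h3

omit [DecidableEq n] in
/-- **B11, closedness.**  The symmetroid Gram cone `{v vᵀ − u uᵀ − w wᵀ}` is closed. [folklore] -/
theorem isClosed_isSymGram : IsClosed {M : Matrix n n ℝ | IsSymGram M} := by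
  have hset : {M : Matrix n n ℝ | IsSymGram M} =
      {M | M.IsSymm} ∩ ({M | TwoPos M}ᶜ ∩ {M | ThreeNeg M}ᶜ) := by
    ext M
    simp only [Set.mem_setOf_eq, Set.mem_inter_iff, Set.mem_compl_iff, isSymGram_iff]
  rw [hset]
  refine IsClosed.inter ?_ (isOpen_twoPos.isClosed_compl.inter isOpen_threeNeg.isClosed_compl)
  have : {M : Matrix n n ℝ | M.IsSymm} = {M | Mᵀ = M} := rfl
  rw [this]
  exact isClosed_eq (continuous_id.matrix_transpose) continuous_id

omit [DecidableEq n] in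
/-- The two-sided cone `{±(v vᵀ − u uᵀ − w wᵀ)}` (the realisable polar Gram matrices of symmetric `2 × 2` pencils,
see `Lines/wall_bubbling.lean` `Realisable`) is closed. [folklore] -/
theorem isClosed_isSymGram_or_neg : IsClosed {M : Matrix n n ℝ | IsSymGram M ∨ IsSymGram (-M)} := by
  have h2 : IsClosed {M : Matrix n n ℝ | IsSymGram (-M)} :=
    isClosed_isSymGram.preimage continuous_neg
  exact isClosed_isSymGram.union h2

/-! ## The letters: realisable polar Gram matrices of symmetric `2 × 2` pencils

`polar` and `Realisable` below are VERBATIM copies (same bodies) of the line file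
`Cruxes/DoorA26/Lines/wall_bubbling.lean` (`…Cruxes.DoorA26.WallBubbling.polar / .Realisable`), so the closedness
statement transfers by `Iff.rfl`-level rewriting once the line file imports this module (or a prover restates it there). -/

/-- Polarisation of the `2 × 2` determinant (verbatim from the line file). -/
noncomputable def polar (S T : Matrix (Fin 2) (Fin 2) ℝ) : ℝ := ((S + T).det - S.det - T.det) / 2

/-- Realisable polar Gram matrices (verbatim from the line file, index `Fin 6`). -/
def Realisable (G : Matrix (Fin 6) (Fin 6) ℝ) : Prop :=
  ∃ (ε : ℝ) (S : Fin 6 → Matrix (Fin 2) (Fin 2) ℝ), (ε = 1 ∨ ε = -1) ∧ (∀ l, (S l).IsSymm) ∧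
    ∀ i j, G i j = ε * polar (S i) (S j)

/-- The polar form of two symmetric `2 × 2` matrices in the coordinates `v = (a+c)/2, u = (a−c)/2, w = b`:
`polar S T = v_S v_T − u_S u_T − w_S w_T` — i.e. `(Sym₂(ℝ), det) ≅ ℝ^{1,2}`. [folklore] -/
theorem polar_eq (S T : Matrix (Fin 2) (Fin 2) ℝ) (hS : S.IsSymm) (hT : T.IsSymm) :
    polar S T = ((S 0 0 + S 1 1) / 2) * ((T 0 0 + T 1 1) / 2) - ((S 0 0 - S 1 1) / 2) * ((T 0 0 - T 1 1) / 2)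
      - S 0 1 * T 0 1 := by
  have hS10 : S 1 0 = S 0 1 := hS.apply 0 1
  have hT10 : T 1 0 = T 0 1 := hT.apply 0 1
  simp only [polar, Matrix.det_fin_two, Matrix.add_apply, hS10, hT10]
  ring

/-- **Realisable = two-sided symmetroid Gram cone**: `Realisable G ↔ IsSymGram G ∨ IsSymGram (−G)`. [folklore] -/
theorem realisable_iff (G : Matrix (Fin 6) (Fin 6) ℝ) : Realisable G ↔ IsSymGram G ∨ IsSymGram (-G) := by
  constructor
  · rintro ⟨ε, S, hε, hS, hG⟩
    -- the three coordinate vectors of the letters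
    let v : Fin 6 → ℝ := fun l => (S l 0 0 + S l 1 1) / 2
    let u : Fin 6 → ℝ := fun l => (S l 0 0 - S l 1 1) / 2
    let w : Fin 6 → ℝ := fun l => S l 0 1
    have hpol : ∀ i j, polar (S i) (S j) = v i * v j - u i * u j - w i * w j := fun i j =>
      polar_eq (S i) (S j) (hS i) (hS j)
    rcases hε with rfl | rfl
    · left
      refine ⟨v, u, w, ?_⟩
      ext i j
      simp only [Matrix.sub_apply, vecMulVec_apply, hG i j, hpol i j, one_mul]
    · right
      refine ⟨v, u, w, ?_⟩
      ext i j
      simp only [Matrix.neg_apply, Matrix.sub_apply, vecMulVec_apply, hG i j, hpol i j]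
      ring
  · -- from `v, u, w` build the symmetric letters `S l = [[v+u, w],[w, v−u]]`
    have build : ∀ (H : Matrix (Fin 6) (Fin 6) ℝ), IsSymGram H →
        ∃ S : Fin 6 → Matrix (Fin 2) (Fin 2) ℝ, (∀ l, (S l).IsSymm) ∧ ∀ i j, H i j = polar (S i) (S j) := by
      rintro H ⟨v, u, w, rfl⟩
      refine ⟨fun l => !![v l + u l, w l; w l, v l - u l], ?_, ?_⟩
      · intro l
        exact Matrix.IsSymm.ext (by intro i j; fin_cases i <;> fin_cases j <;> rfl)
      · intro i j
        rw [polar_eq _ _ (Matrix.IsSymm.ext (by intro a b; fin_cases a <;> fin_cases b <;> rfl))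
          (Matrix.IsSymm.ext (by intro a b; fin_cases a <;> fin_cases b <;> rfl))]
        simp only [Matrix.sub_apply, vecMulVec_apply, Matrix.of_apply, Matrix.cons_val', Matrix.cons_val_zero,
          Matrix.cons_val_one, Matrix.cons_val_fin_one]
        ring
    rintro (h | h)
    · obtain ⟨S, hS, hH⟩ := build G h
      exact ⟨1, S, Or.inl rfl, hS, fun i j => by rw [one_mul]; exact hH i j⟩
    · obtain ⟨S, hS, hH⟩ := build (-G) h
      refine ⟨-1, S, Or.inr rfl, hS, fun i j => ?_⟩
      have := hH i j
      rw [Matrix.neg_apply] at this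
      linarith

/-- **B11.**  The realisable cone is closed (so blow-up limits of realisable polar Gram matrices stay realisable).
[folklore] -/
theorem isClosed_realisable : IsClosed {G : Matrix (Fin 6) (Fin 6) ℝ | Realisable G} := by
  have : {G : Matrix (Fin 6) (Fin 6) ℝ | Realisable G} = {G | IsSymGram G ∨ IsSymGram (-G)} := by
    ext G; exact realisable_iff G
  rw [this]
  exact isClosed_isSymGram_or_neg

/-- **B11, sequential form** (the shape used in B12): an entrywise limit of realisable matrices is realisable. -/
theorem realisable_of_tendsto {Gseq : ℕ → Matrix (Fin 6) (Fin 6) ℝ} {G : Matrix (Fin 6) (Fin 6) ℝ}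
    (hreal : ∀ ν, Realisable (Gseq ν)) (hlim : Filter.Tendsto Gseq Filter.atTop (nhds G)) : Realisable G :=
  isClosed_realisable.mem_of_tendsto hlim (Filter.Eventually.of_forall hreal)


end Summit.ValiantsHypothesis.ValiantsHypothesis.Cruxes.DoorA26.WallBubbling.Assembly.Inertia


/-! # Part VI — the assembly (S3a–c, B10b, B12) -/

namespace Summit.ValiantsHypothesis.ValiantsHypothesis.Cruxes.DoorA26.WallBubbling.Assembly

open Finset Filter Topology
open Summit.ValiantsHypothesis.ValiantsHypothesis.Cruxes.DoorA26.WallBubbling.Assembly.TwistedRolle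
open Summit.ValiantsHypothesis.ValiantsHypothesis.Cruxes.DoorA26.WallBubbling.Assembly.Clusters
open Summit.ValiantsHypothesis.ValiantsHypothesis.Cruxes.DoorA26.WallBubbling.Assembly.Config

/-! ## Verbatim copies of the line's definitions (`Lines/wall_bubbling.lean`) -/

/-- The open twenty-locus (verbatim). -/
def TwentyLocus : Set (Fin 6 → ℝ) :=
  {δ | ∃ S : Fin 6 → Matrix (Fin 2) (Fin 2) ℝ, (∀ l, (S l).IsSymm) ∧
    20 ≤ {x : ℝ | 0 < x ∧ (∑ l, (x ^ (δ l)) • S l).det = 0}.ncard}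

/-- The sorted simplex (verbatim). -/
def SortedSimplex : Set (Fin 6 → ℝ) := {δ | Monotone δ ∧ δ 0 = 0 ∧ δ (Fin.last 5) = 1}

/-- Polarisation of `det` (verbatim). -/
noncomputable def polar (S T : Matrix (Fin 2) (Fin 2) ℝ) : ℝ := ((S + T).det - S.det - T.det) / 2

/-- Realisable polar Gram matrices (verbatim). -/
def Realisable (G : Matrix (Fin 6) (Fin 6) ℝ) : Prop :=
  ∃ (ε : ℝ) (S : Fin 6 → Matrix (Fin 2) (Fin 2) ℝ), (ε = 1 ∨ ε = -1) ∧ (∀ l, (S l).IsSymm) ∧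
    ∀ i j, G i j = ε * polar (S i) (S j)

/-- Block sums over pair-sum value classes vanish (verbatim). -/
def BlockSumsZero (δ : Fin 6 → ℝ) (G : Matrix (Fin 6) (Fin 6) ℝ) : Prop :=
  ∀ v : ℝ, (∑ k, ∑ l, if δ k + δ l = v then G k l else 0) = 0

/-- Obligation (B) of the line, verbatim. -/
def Stmt.stub_bubbling : Prop :=
  ∀ δ ∈ SortedSimplex, δ ∈ closure TwentyLocus →
    (∃ i j k l : Fin 6, (i, j) ≠ (k, l) ∧ (i, j) ≠ (l, k) ∧ δ i + δ j = δ k + δ l) →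
      ∃ G : Matrix (Fin 6) (Fin 6) ℝ, G ≠ 0 ∧ BlockSumsZero δ G ∧ Realisable G

/-- The copies agree with Parts IV–V (same bodies). -/
theorem polar_eq_normalisation : polar = Normalisation.polar := rfl
theorem realisable_iff_inertia (G : Matrix (Fin 6) (Fin 6) ℝ) : Realisable G ↔ Inertia.Realisable G := Iff.rfl
theorem realisable_iff_normalisation (G : Matrix (Fin 6) (Fin 6) ℝ) : Realisable G ↔ Normalisation.Realisable G := Iff.rfl

/-! ## The typed output of the bookkeeping (B4–B7, B11): cluster limits -/

/-- Members = ordered index pairs; the member `(k,l)` carries the exponent `δ k + δ l`. -/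
abbrev Pair := Fin 6 × Fin 6

/-- The exponent of a member. -/
def pairExp (δ : Fin 6 → ℝ) : Pair → ℝ := fun p => δ p.1 + δ p.2

/-- **Cluster-limit data at `δ⋆`** — what B4–B7 (+ B11) extract from a sequence `δ^ν → δ⋆` in the twenty-locus:
`C` zero clusters carrying `m c` zeros each (`∑ m c = 20`); per cluster the recentred, max-normalised coefficient
sequences `a c ν : Pair → ℝ` (moduli `≤ 1`) converging to `H c ≠ 0`, each `H c` realisable (closedness of the
realisable cone, B11); for every `ν` the `m c` zeros of the `ν`-th window function `expSum (a c ν) (pairExp (δseq ν))`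
in `[−R c, R c]`; and for clusters `c < c′` the exact member-wise transfer `a c′ ν p = a c ν p · exp (xₚ L) · ρ`
with `L → +∞`, `ρ > 0` (same Gram matrix, two normalisations). -/
structure ClusterLimit (δstar : Fin 6 → ℝ) where
  /-- number of clusters -/
  C : ℕ
  /-- zeros per cluster -/
  m : Fin C → ℕ
  hm : ∑ c, m c = 20
  /-- the exponent vectors along the extracted subsequence -/
  δseq : ℕ → Fin 6 → ℝ
  hδ : ∀ l, Tendsto (fun ν => δseq ν l) atTop (𝓝 (δstar l))
  /-- normalised recentred coefficients per cluster, and their limits -/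
  a : Fin C → ℕ → Pair → ℝ
  H : Fin C → Pair → ℝ
  ha : ∀ c p, Tendsto (fun ν => a c ν p) atTop (𝓝 (H c p))
  hbound : ∀ c ν p, |a c ν p| ≤ 1
  hH : ∀ c, H c ≠ 0
  hreal : ∀ c, Realisable (Matrix.of fun k l => H c (k, l))
  /-- window radii and the zeros -/
  R : Fin C → ℝ
  hzeros : ∀ c ν, ∃ Z : Finset ℝ, Z.card = m c ∧
    ∀ z ∈ Z, z ∈ Set.Icc (-(R c)) (R c) ∧ expSum (a c ν) (pairExp (δseq ν)) z = 0
  /-- inter-cluster distances and normalisation ratios -/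
  L : Fin C → Fin C → ℕ → ℝ
  ρ : Fin C → Fin C → ℕ → ℝ
  hρ : ∀ c c' ν, 0 < ρ c c' ν
  hL : ∀ c c', c < c' → Tendsto (L c c') atTop atTop
  htransfer : ∀ c c', c < c' → ∀ ν p, a c' ν p = a c ν p * Real.exp (pairExp (δseq ν) p * L c c' ν) * ρ c c' ν

/-- Block sums of the matrix of `H` are the class sums of `H` for the member exponents. -/
theorem blockSum_eq_classSum (δ : Fin 6 → ℝ) (H : Pair → ℝ) (v : ℝ) :
    (∑ k, ∑ l, if δ k + δ l = v then (Matrix.of fun k l => H (k, l)) k l else 0) = classSum H (pairExp δ) v := by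
  unfold classSum pairExp
  rw [← Finset.sum_product']
  rfl

/-! ## B10b — the count -/

/-- **B10b.**  At a `δ⋆` with a pair-sum coincidence, a cluster limit in which every cluster keeps an active limit
class is absurd: B3 bounds the zeros of cluster `c` by `|Λ_c| − 1`, B8 orders the `Λ_c`, B9 sums to `≤ |V| − 1`, B10a gives
`|V| ≤ 20`, against `∑ m c = 20`. [folklore] -/
theorem count_absurd {δstar : Fin 6 → ℝ} (D : ClusterLimit δstar)
    (hcoin : ∃ i j k l : Fin 6, (i, j) ≠ (k, l) ∧ (i, j) ≠ (l, k) ∧ δstar i + δstar j = δstar k + δstar l)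
    (hact : ∀ c, ∃ w, classSum (D.H c) (pairExp δstar) w ≠ 0) : False := by
  classical
  -- the value set and its size
  set V : Finset ℝ := Finset.univ.image (fun p : Fin 6 × Fin 6 => δstar p.1 + δstar p.2) with hVdef
  have hV : V.card ≤ 20 := card_pairSums_le_twenty δstar hcoin
  -- exponents converge member-wise
  have hx : ∀ p : Pair, Tendsto (fun ν => pairExp (D.δseq ν) p) atTop (𝓝 (pairExp δstar p)) :=
    fun p => (D.hδ p.1).add (D.hδ p.2)
  -- a nonzero class has a member, hence its value lies in `V`
  have hmemV : ∀ c w, classSum (D.H c) (pairExp δstar) w ≠ 0 → w ∈ V := by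
    intro c w hw
    obtain ⟨p, hp, -⟩ := exists_member_of_classSum_ne_zero (D.H c) (pairExp δstar) w hw
    rw [hVdef, Finset.mem_image]
    exact ⟨p, Finset.mem_univ _, hp⟩
  -- the active value sets
  set Λ : Fin D.C → Finset ℝ := fun c => V.filter fun w => classSum (D.H c) (pairExp δstar) w ≠ 0 with hΛdef
  have hΛmem : ∀ c w, w ∈ Λ c ↔ classSum (D.H c) (pairExp δstar) w ≠ 0 := by
    intro c w
    rw [hΛdef, Finset.mem_filter]
    exact ⟨fun h => h.2, fun h => ⟨hmemV c w h, h⟩⟩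
  have hΛsub : ∀ c, Λ c ⊆ V := fun c => Finset.filter_subset _ _
  have hΛne : ∀ c, (Λ c).Nonempty := by
    intro c
    obtain ⟨w, hw⟩ := hact c
    exact ⟨w, (hΛmem c w).mpr hw⟩
  -- (1) per-cluster count, by B3
  have hcount : ∀ c, D.m c + 1 ≤ (Λ c).card := by
    intro c
    have hev := robust_term_count' (D.a c) (fun ν => pairExp (D.δseq ν)) (D.H c) (pairExp δstar) (Λ c)
      (D.ha c) hx (fun w hw => (hΛmem c w).mpr hw) (hact c) (D.R c)
    obtain ⟨ν, hν⟩ := hev.exists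
    obtain ⟨Z, hZcard, hZ⟩ := D.hzeros c ν
    have := hν Z hZ
    omega
  -- (2) monotone ordering of the active sets, by B8 (member-wise)
  have hmono : ∀ c c', c < c' → ∀ w ∈ Λ c, ∀ w' ∈ Λ c', w ≤ w' := by
    intro c c' hcc' w hw w' hw'
    obtain ⟨p, hp, hHp⟩ := exists_member_of_classSum_ne_zero (D.H c) (pairExp δstar) w ((hΛmem c w).mp hw)
    obtain ⟨p', hp', hHp'⟩ := exists_member_of_classSum_ne_zero (D.H c') (pairExp δstar) w' ((hΛmem c' w').mp hw')
    have := tropical_monotone (fun ν => pairExp (D.δseq ν)) (D.a c) (D.a c') (pairExp δstar) (D.H c) (D.H c')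
      (D.L c c') (D.ρ c c') hx (D.ha c) (D.ha c') (D.hbound c) (D.hbound c') (D.hρ c c') (D.hL c c' hcc')
      (D.htransfer c c' hcc') hHp hHp'
    rw [hp, hp'] at this
    exact this
  -- (3) the interval count, by B9
  have hint : ∑ c, ((Λ c).card - 1) ≤ V.card - 1 := interval_count V Λ hΛne hΛsub hmono
  -- (4) arithmetic
  have hsum : ∑ c, D.m c ≤ ∑ c, ((Λ c).card - 1) :=
    Finset.sum_le_sum fun c _ => by have := hcount c; omega
  have h20 := D.hm
  omega

/-! ## B12 — composition into obligation (B) -/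

/-- **B12 composition.**  If every `δ⋆` in the closure of the twenty-locus carries cluster-limit data, obligation (B)
holds: either some cluster blows up — its limit `H c ≠ 0` has all `δ⋆`-block sums zero and is realisable, i.e. it IS the wanted
pattern — or every cluster keeps an active class and `count_absurd` applies. -/
theorem stub_bubbling_of
    (hS3 : ∀ δstar : Fin 6 → ℝ, δstar ∈ closure TwentyLocus → Nonempty (ClusterLimit δstar)) :
    Stmt.stub_bubbling := by
  intro δstar _ hclos hcoin
  obtain ⟨D⟩ := hS3 δstar hclos
  by_cases hblow : ∃ c, ∀ w, classSum (D.H c) (pairExp δstar) w = 0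
  · obtain ⟨c, hc⟩ := hblow
    refine ⟨Matrix.of fun k l => D.H c (k, l), ?_, ?_, D.hreal c⟩
    · intro hzero
      apply D.hH c
      funext p
      have := congrFun (congrFun hzero p.1) p.2
      simpa using this
    · intro v
      rw [blockSum_eq_classSum]
      exact hc v
  · push Not at hblow
    exact (count_absurd D hcoin hblow).elim

/-! ## S3a — unpacking the twenty-locus (B5) -/

/-- Recentring/rescaling an exponential sum. -/
theorem expSum_recenter (G x : Pair → ℝ) (r s t : ℝ) :
    expSum (fun p => r * (G p * Real.exp (x p * s))) x t = r * expSum G x (t + s) := by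
  unfold expSum
  rw [Finset.mul_sum]
  refine Finset.sum_congr rfl fun p _ => ?_
  rw [mul_add, Real.exp_add]
  ring

/-- The pencil determinant along `x = exp t` is the `expSum` of the polar Gram coefficients over the members. -/
theorem det_pencil_exp (δ : Fin 6 → ℝ) (S : Fin 6 → Matrix (Fin 2) (Fin 2) ℝ) (t : ℝ) :
    (∑ l, ((Real.exp t) ^ (δ l)) • S l).det = expSum (fun p : Pair => polar (S p.1) (S p.2)) (pairExp δ) t := by
  rw [polar_eq_normalisation, Normalisation.det_rpow_pencil δ S (Real.exp_pos t)]
  unfold expSum pairExp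
  rw [← Finset.sum_product']
  refine Finset.sum_congr rfl fun p _ => ?_
  rw [Normalisation.rpow_exp_eq]

/-- **S3a.**  A point of the twenty-locus yields symmetric letters with a NONZERO polar Gram vector and `20` strictly increasing
real zeros of the associated `expSum`. [folklore] -/
theorem zeros_of_mem_twentyLocus {δ : Fin 6 → ℝ} (hδ : δ ∈ TwentyLocus) :
    ∃ S : Fin 6 → Matrix (Fin 2) (Fin 2) ℝ, (∀ l, (S l).IsSymm) ∧
      (fun p : Pair => polar (S p.1) (S p.2)) ≠ 0 ∧
      ∃ z : Fin 20 → ℝ, StrictMono z ∧ ∀ j, expSum (fun p : Pair => polar (S p.1) (S p.2)) (pairExp δ) (z j) = 0 := by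
  classical
  obtain ⟨S, hS, h20⟩ := hδ
  set Zpos : Set ℝ := {x : ℝ | 0 < x ∧ (∑ l, (x ^ (δ l)) • S l).det = 0} with hZpos
  refine ⟨S, hS, ?_, ?_⟩
  · -- nonzero Gram vector: otherwise the determinant vanishes on `(0, ∞)` and `ncard = 0`
    intro hG
    have hall : ∀ x : ℝ, 0 < x → (∑ l, (x ^ (δ l)) • S l).det = 0 := by
      intro x hx
      rw [polar_eq_normalisation] at hG
      rw [Normalisation.det_rpow_pencil δ S hx]
      refine Finset.sum_eq_zero fun k _ => Finset.sum_eq_zero fun l _ => ?_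
      have := congrFun hG (k, l)
      simp only [Pi.zero_apply] at this
      rw [this, zero_mul]
    have hIoi : Zpos = Set.Ioi 0 := by
      ext x
      simp only [hZpos, Set.mem_setOf_eq, Set.mem_Ioi]
      exact ⟨fun h => h.1, fun h => ⟨h, hall x h⟩⟩
    have : Zpos.ncard = 0 := by rw [hIoi]; exact (Set.Ioi_infinite 0).ncard
    rw [this] at h20
    omega
  · -- twenty sorted positive zeros, then logarithms
    obtain ⟨T, hTsub, hTcard⟩ := Set.exists_subset_card_eq h20
    have hTfin : T.Finite := Set.finite_of_ncard_pos (by omega)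
    set TF : Finset ℝ := hTfin.toFinset with hTF
    have hTFcard : TF.card = 20 := by
      rw [hTF, ← Set.ncard_eq_toFinset_card T hTfin]; exact hTcard
    let e : Fin 20 ↪o ℝ := TF.orderEmbOfFin hTFcard
    have heT : ∀ j, e j ∈ T := fun j => by
      have h2 : e j ∈ hTfin.toFinset := Finset.orderEmbOfFin_mem TF hTFcard j
      exact hTfin.mem_toFinset.mp h2
    have hepos : ∀ j, 0 < e j := fun j => (hTsub (heT j)).1
    refine ⟨fun j => Real.log (e j), ?_, ?_⟩
    · intro i j hij
      exact Real.log_lt_log (hepos i) (e.strictMono hij)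
    · intro j
      have hz := (hTsub (heT j)).2
      rw [← det_pencil_exp, Real.exp_log (hepos j)]
      exact hz

/-! ## S3b — blocks of zeros (B4 + B6 bookkeeping) -/

/-- **Blocks.**  For strictly increasing `20`-point configurations `z ν` there are: a subsequence `φ`, a number `C` of blocks,
block START indices `start : Fin C → Fin 20` (strictly increasing), a block assignment `blk : Fin 20 → Fin C` with
`start (blk j) ≤ j`, and a radius `R`, such that every point stays within `R` above the start of its block and the starts of
different blocks drift apart to `+∞`. [folklore: Bolzano–Weierstrass bookkeeping] -/
theorem blocks (z : ℕ → Fin 20 → ℝ) (hz : ∀ ν, StrictMono (z ν)) :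
    ∃ φ : ℕ → ℕ, StrictMono φ ∧ ∃ (C : ℕ) (start : Fin C → Fin 20) (blk : Fin 20 → Fin C) (R : ℝ),
      StrictMono start ∧ (∀ j, start (blk j) ≤ j) ∧
      (∀ ν j, z (φ ν) j - z (φ ν) (start (blk j)) ∈ Set.Icc (-R) R) ∧
      (∀ c c', c < c' → Tendsto (fun ν => z (φ ν) (start c') - z (φ ν) (start c)) atTop atTop) := by
  classical
  obtain ⟨φ, hφ, B, hB⟩ := cluster_dichotomy (N := 19) z
  -- unbounded gaps
  set U : Finset (Fin 19) := Finset.univ.filter fun k => ¬ ∀ n, z (φ n) k.succ - z (φ n) k.castSucc ≤ B with hU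
  have hUb : ∀ k, k ∉ U → ∀ n, z (φ n) k.succ - z (φ n) k.castSucc ≤ B := by
    intro k hk
    by_contra h
    exact hk (Finset.mem_filter.mpr ⟨Finset.mem_univ _, h⟩)
  have hUt : ∀ k, k ∈ U → Tendsto (fun n => z (φ n) k.succ - z (φ n) k.castSucc) atTop atTop := by
    intro k hk
    rcases hB k with h | h
    · exact absurd h (Finset.mem_filter.mp hk).2
    · exact h
  -- block starts
  set T : Finset (Fin 20) := insert 0 (U.image Fin.succ) with hT
  set C := T.card with hC
  let start : Fin C ↪o Fin 20 := T.orderEmbOfFin hC.symm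
  have hstartT : ∀ c, start c ∈ T := fun c => Finset.orderEmbOfFin_mem T hC.symm c
  have hTstart : ∀ t ∈ T, ∃ c, start c = t := by
    intro t ht
    have : t ∈ Set.range (T.orderEmbOfFin hC.symm) := by rw [Finset.range_orderEmbOfFin]; exact ht
    obtain ⟨c, hc⟩ := this
    exact ⟨c, hc⟩
  have h0T : (0 : Fin 20) ∈ T := Finset.mem_insert_self _ _
  -- block assignment
  have hne : ∀ j : Fin 20, (Finset.univ.filter fun c : Fin C => start c ≤ j).Nonempty := by
    intro j
    obtain ⟨c₀, hc₀⟩ := hTstart 0 h0T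
    exact ⟨c₀, Finset.mem_filter.mpr ⟨Finset.mem_univ _, by rw [hc₀]; exact Fin.zero_le _⟩⟩
  let blk : Fin 20 → Fin C := fun j => (Finset.univ.filter fun c : Fin C => start c ≤ j).max' (hne j)
  have hblk1 : ∀ j, start (blk j) ≤ j := fun j =>
    (Finset.mem_filter.mp (Finset.max'_mem _ (hne j))).2
  have hblk2 : ∀ j c', start c' ≤ j → c' ≤ blk j := fun j c' h =>
    Finset.le_max' (Finset.univ.filter fun c : Fin C => start c ≤ j) c'
      (Finset.mem_filter.mpr ⟨Finset.mem_univ _, h⟩)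
  -- gaps inside a block are bounded gaps
  have hinside : ∀ (j : Fin 20) (k : Fin 19), start (blk j) ≤ k.castSucc → k.succ ≤ j → k ∉ U := by
    intro j k h1 h2 hkU
    have hkT : k.succ ∈ T := Finset.mem_insert_of_mem (Finset.mem_image_of_mem _ hkU)
    obtain ⟨c', hc'⟩ := hTstart _ hkT
    have hc'le : c' ≤ blk j := hblk2 j c' (by rw [hc']; exact h2)
    have : start c' ≤ start (blk j) := start.monotone hc'le
    rw [hc'] at this
    have h3 : (k.castSucc : Fin 20) < k.succ := Fin.castSucc_lt_succ
    exact absurd (lt_of_lt_of_le h3 (le_trans this h1)) (lt_irrefl _)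
  refine ⟨φ, hφ, C, start, blk, 19 * |B|, start.strictMono, hblk1, ?_, ?_⟩
  · -- the window
    intro ν j
    set i₀ := start (blk j) with hi₀
    have hmono : Monotone (z (φ ν)) := (hz (φ ν)).monotone
    have hlow : 0 ≤ z (φ ν) j - z (φ ν) i₀ := sub_nonneg.mpr (hmono (hblk1 j))
    -- telescoping along `u n = z (φ ν) n` (extended by `0` beyond `19`)
    let u : ℕ → ℝ := fun n => if h : n < 20 then z (φ ν) ⟨n, h⟩ else 0
    have hu : ∀ (q : Fin 20), u q.val = z (φ ν) q := by
      intro q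
      simp only [u, dif_pos q.isLt]
    have hgap : ∀ k : ℕ, i₀.val ≤ k → k < j.val → u (k + 1) - u k ≤ B := by
      intro k hk hkj
      have hk19 : k < 19 := by have := j.isLt; omega
      set kf : Fin 19 := ⟨k, hk19⟩ with hkf
      have hnot : kf ∉ U := hinside j kf (by rw [Fin.le_def]; simpa [hkf] using hk)
        (by rw [Fin.le_def]; simp [hkf]; omega)
      have := hUb kf hnot ν
      have e1 : u (k + 1) = z (φ ν) kf.succ := by
        have := hu kf.succ; simpa [hkf] using this
      have e2 : u k = z (φ ν) kf.castSucc := by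
        have := hu kf.castSucc; simpa [hkf] using this
      rw [e1, e2]; exact this
    have htel := telescoping_bound u B i₀.val j.val (hblk1 j) hgap
    rw [hu j, hu i₀] at htel
    have hdiff : ((j.val - i₀.val : ℕ) : ℝ) ≤ 19 := by
      have := j.isLt
      exact_mod_cast (by omega : j.val - i₀.val ≤ 19)
    refine ⟨by linarith [abs_nonneg B], ?_⟩
    calc z (φ ν) j - z (φ ν) i₀ ≤ ((j.val - i₀.val : ℕ) : ℝ) * B := htel
      _ ≤ ((j.val - i₀.val : ℕ) : ℝ) * |B| := by
          exact mul_le_mul_of_nonneg_left (le_abs_self B) (by positivity)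
      _ ≤ 19 * |B| := mul_le_mul_of_nonneg_right hdiff (abs_nonneg B)
  · -- starts drift apart
    intro c c' hcc'
    have hlt : start c < start c' := start.strictMono hcc'
    have hT' : start c' ∈ T := hstartT c'
    rw [hT, Finset.mem_insert, Finset.mem_image] at hT'
    rcases hT' with h0 | ⟨k, hkU, hk⟩
    · exact absurd (lt_of_lt_of_le hlt (by rw [h0]; exact Fin.zero_le _)) (lt_irrefl _)
    · -- `start c ≤ k.castSucc < k.succ = start c'`
      have hle : start c ≤ k.castSucc := by
        rw [← hk] at hlt
        rw [Fin.le_def]; rw [Fin.lt_def] at hlt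
        simp [Fin.val_succ] at hlt ⊢; omega
      refine tendsto_atTop_mono (fun ν => ?_) (hUt k hkU)
      rw [← hk]
      have := (hz (φ ν)).monotone hle
      linarith

/-! ## S3c — normalisation, limits, realisability (B5, B7, B11) -/

/-- `polar` is bilinear in scalars. -/
theorem polar_smul_left_right (a b : ℝ) (S T : Matrix (Fin 2) (Fin 2) ℝ) :
    polar (a • S) (b • T) = a * b * polar S T := by
  rw [polar_eq_normalisation, Normalisation.polar_apply, Normalisation.polar_apply]
  simp only [Matrix.smul_apply, smul_eq_mul]
  ring

/-- A recentred, rescaled polar Gram vector is realisable (letters `Sₗ ↦ exp(δₗ s) • Sₗ`, then scale). -/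
theorem realisable_recentred (δ : Fin 6 → ℝ) (S : Fin 6 → Matrix (Fin 2) (Fin 2) ℝ) (hS : ∀ l, (S l).IsSymm)
    (r s : ℝ) :
    Realisable (Matrix.of fun k l => r * (polar (S k) (S l) * Real.exp (pairExp δ (k, l) * s))) := by
  have h1 : Realisable (Matrix.of fun k l => polar (Real.exp (δ k * s) • S k) (Real.exp (δ l * s) • S l)) := by
    rw [realisable_iff_normalisation]
    exact Normalisation.realisable_polarGram (fun l => Real.exp (δ l * s) • S l) (fun l => (hS l).smul _)
  have h2 := (realisable_iff_normalisation _).mpr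
    (Normalisation.realisable_smul r ((realisable_iff_normalisation _).mp h1))
  convert h2 using 1
  ext k l
  simp only [Matrix.of_apply, Matrix.smul_apply, smul_eq_mul, polar_smul_left_right, pairExp]
  rw [add_mul, Real.exp_add]
  ring

/-- **S3c.**  From the zero data (S3a along a sequence) and the block data (S3b) build the cluster limit. [folklore] -/
theorem clusterLimit_of_data (δstar : Fin 6 → ℝ) (δseq : ℕ → Fin 6 → ℝ)
    (hδ : ∀ l, Tendsto (fun ν => δseq ν l) atTop (𝓝 (δstar l)))
    (S : ℕ → Fin 6 → Matrix (Fin 2) (Fin 2) ℝ) (hS : ∀ ν l, (S ν l).IsSymm)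
    (hG0 : ∀ ν, (fun p : Pair => polar (S ν p.1) (S ν p.2)) ≠ 0)
    (z : ℕ → Fin 20 → ℝ) (hz : ∀ ν, StrictMono (z ν))
    (hzero : ∀ ν j, expSum (fun p : Pair => polar (S ν p.1) (S ν p.2)) (pairExp (δseq ν)) (z ν j) = 0)
    (C : ℕ) (start : Fin C → Fin 20) (blk : Fin 20 → Fin C) (R : ℝ)
    (hwin : ∀ ν j, z ν j - z ν (start (blk j)) ∈ Set.Icc (-R) R)
    (hdrift : ∀ c c', c < c' → Tendsto (fun ν => z ν (start c') - z ν (start c)) atTop atTop) :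
    Nonempty (ClusterLimit δstar) := by
  classical
  -- Gram vectors, centres, recentred vectors, norms, normalised vectors
  let G : ℕ → Pair → ℝ := fun ν p => polar (S ν p.1) (S ν p.2)
  let s : Fin C → ℕ → ℝ := fun c ν => z ν (start c)
  let b : Fin C → ℕ → Pair → ℝ := fun c ν p => G ν p * Real.exp (pairExp (δseq ν) p * s c ν)
  have hb0 : ∀ c ν, b c ν ≠ 0 := by
    intro c ν hb
    apply hG0 ν
    funext p
    have := congrFun hb p
    simp only [b, Pi.zero_apply, mul_eq_zero, Real.exp_ne_zero, or_false] at this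
    simpa [G] using this
  let N : Fin C → ℕ → ℝ := fun c ν => ‖b c ν‖
  have hNpos : ∀ c ν, 0 < N c ν := fun c ν => norm_pos_iff.mpr (hb0 c ν)
  let a : Fin C → ℕ → Pair → ℝ := fun c ν p => (N c ν)⁻¹ * (G ν p * Real.exp (pairExp (δseq ν) p * s c ν))
  have ha_eq : ∀ c ν, a c ν = (N c ν)⁻¹ • b c ν := by
    intro c ν; funext p; simp only [a, b, Pi.smul_apply, smul_eq_mul]
  have hnorm_a : ∀ c ν, ‖a c ν‖ = 1 := by
    intro c ν
    rw [ha_eq, norm_smul, norm_inv, Real.norm_of_nonneg (norm_nonneg _)]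
    exact inv_mul_cancel₀ (hNpos c ν).ne'
  have hbound : ∀ c ν p, |a c ν p| ≤ 1 := by
    intro c ν p
    have := norm_le_pi_norm (a c ν) p
    rw [Real.norm_eq_abs, hnorm_a] at this
    exact this
  -- Bolzano–Weierstrass in `Fin C → Pair → ℝ`
  let A : ℕ → (Fin C → Pair → ℝ) := fun ν c => a c ν
  have hAball : ∀ ν, A ν ∈ Metric.closedBall (0 : Fin C → Pair → ℝ) 1 := by
    intro ν
    rw [Metric.mem_closedBall, dist_zero_right]
    refine (pi_norm_le_iff_of_nonneg zero_le_one).mpr fun c => ?_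
    exact (hnorm_a c ν).le
  obtain ⟨Hfull, -, ψ, hψ, hlim⟩ := tendsto_subseq_of_bounded Metric.isBounded_closedBall hAball
  have hlim_c : ∀ c, Tendsto (fun ν => a c (ψ ν)) atTop (𝓝 (Hfull c)) := fun c =>
    (tendsto_pi_nhds.mp hlim) c
  have hlim_cp : ∀ c p, Tendsto (fun ν => a c (ψ ν) p) atTop (𝓝 (Hfull c p)) := fun c p =>
    (tendsto_pi_nhds.mp (hlim_c c)) p
  have hHne : ∀ c, Hfull c ≠ 0 := by
    intro c
    have h1 : Tendsto (fun ν => ‖a c (ψ ν)‖) atTop (𝓝 ‖Hfull c‖) := (hlim_c c).norm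
    have h2 : Tendsto (fun ν => ‖a c (ψ ν)‖) atTop (𝓝 1) := by
      simp only [hnorm_a]; exact tendsto_const_nhds
    have : ‖Hfull c‖ = 1 := tendsto_nhds_unique h1 h2
    intro h0
    rw [h0, norm_zero] at this
    exact zero_ne_one this
  -- the structure
  refine ⟨{
    C := C
    m := fun c => (Finset.univ.filter fun j : Fin 20 => blk j = c).card
    hm := ?_
    δseq := fun ν => δseq (ψ ν)
    hδ := fun l => (hδ l).comp hψ.tendsto_atTop
    a := fun c ν => a c (ψ ν)
    H := Hfull
    ha := hlim_cp
    hbound := fun c ν p => hbound c (ψ ν) p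
    hH := hHne
    hreal := ?_
    R := fun _ => R
    hzeros := ?_
    L := fun c c' ν => s c' (ψ ν) - s c (ψ ν)
    ρ := fun c c' ν => N c (ψ ν) / N c' (ψ ν)
    hρ := fun c c' ν => div_pos (hNpos c _) (hNpos c' _)
    hL := fun c c' hcc' => (hdrift c c' hcc').comp hψ.tendsto_atTop
    htransfer := ?_ }⟩
  · -- ∑ m c = 20
    have := Finset.card_eq_sum_card_fiberwise (f := blk) (s := (Finset.univ : Finset (Fin 20)))
      (t := (Finset.univ : Finset (Fin C))) (fun _ _ => Finset.mem_univ _)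
    rw [Finset.card_univ, Fintype.card_fin] at this
    exact this.symm
  · -- realisability of the limits (B11)
    intro c
    rw [realisable_iff_inertia]
    refine Inertia.realisable_of_tendsto (Gseq := fun ν => Matrix.of fun k l => a c (ψ ν) (k, l)) ?_ ?_
    · intro ν
      rw [← realisable_iff_inertia]
      exact realisable_recentred (δseq (ψ ν)) (S (ψ ν)) (hS (ψ ν)) (N c (ψ ν))⁻¹ (s c (ψ ν))
    · exact tendsto_pi_nhds.mpr fun k => tendsto_pi_nhds.mpr fun l => hlim_cp c (k, l)
  · -- the zeros of cluster `c` in the window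
    intro c ν
    refine ⟨(Finset.univ.filter fun j : Fin 20 => blk j = c).image fun j => z (ψ ν) j - s c (ψ ν), ?_, ?_⟩
    · rw [Finset.card_image_of_injective]
      intro j j' h
      exact (hz (ψ ν)).injective (sub_left_injective h)
    · intro w hw
      obtain ⟨j, hj, rfl⟩ := Finset.mem_image.mp hw
      have hjc : blk j = c := (Finset.mem_filter.mp hj).2
      refine ⟨?_, ?_⟩
      · have := hwin (ψ ν) j
        rw [hjc] at this
        exact this
      · show expSum (a c (ψ ν)) (pairExp (δseq (ψ ν))) (z (ψ ν) j - s c (ψ ν)) = 0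
        rw [show a c (ψ ν) = fun p => (N c (ψ ν))⁻¹ * (G (ψ ν) p * Real.exp (pairExp (δseq (ψ ν)) p * s c (ψ ν)))
          from rfl, expSum_recenter, sub_add_cancel, hzero, mul_zero]
  · -- the transfer identity between clusters
    intro c c' _ ν p
    show a c' (ψ ν) p = a c (ψ ν) p * Real.exp (pairExp (δseq (ψ ν)) p * (s c' (ψ ν) - s c (ψ ν)))
      * (N c (ψ ν) / N c' (ψ ν))
    simp only [a]
    have hN := (hNpos c (ψ ν)).ne'
    have hN' := (hNpos c' (ψ ν)).ne'
    rw [mul_sub, Real.exp_sub]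
    field_simp

/-! ## S3 and obligation (B) -/

/-- **S3.**  Every `δ⋆` in the closure of the twenty-locus carries cluster-limit data. [folklore] -/
theorem clusterLimit_of_mem_closure :
    ∀ δstar : Fin 6 → ℝ, δstar ∈ closure TwentyLocus → Nonempty (ClusterLimit δstar) := by
  intro δstar hclos
  obtain ⟨δseq₀, hmem, hlim₀⟩ := mem_closure_iff_seq_limit.mp hclos
  -- S3a at every `ν`
  choose S hS hG0 z hz hzero using fun ν => zeros_of_mem_twentyLocus (hmem ν)
  -- S3b
  obtain ⟨φ, hφ, C, start, blk, R, -, -, hwin, hdrift⟩ := blocks z hz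
  -- S3c along `φ`
  have hδ : ∀ l, Tendsto (fun ν => δseq₀ (φ ν) l) atTop (𝓝 (δstar l)) := fun l =>
    ((tendsto_pi_nhds.mp hlim₀) l).comp hφ.tendsto_atTop
  exact clusterLimit_of_data δstar (fun ν => δseq₀ (φ ν)) hδ (fun ν => S (φ ν)) (fun ν => hS (φ ν))
    (fun ν => hG0 (φ ν)) (fun ν => z (φ ν)) (fun ν => hz (φ ν)) (fun ν => hzero (φ ν)) C start blk R
    (fun ν j => hwin ν j) hdrift

/-- **Obligation (B) `Stmt.stub_bubbling` (verbatim copy) — PROVED from Parts I–VI.** -/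
theorem stub_bubbling_proof : Stmt.stub_bubbling :=
  stub_bubbling_of clusterLimit_of_mem_closure

end Summit.ValiantsHypothesis.ValiantsHypothesis.Cruxes.DoorA26.WallBubbling.Assembly
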